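import Literature.Analysis.FluidPDE.BackwardUniquenessCoreSecond
import Literature.Analysis.FluidPDE.BackwardUniquenessCutoffSecondEta
import Literature.Analysis.FluidPDE.BackwardUniquenessWeights
import Literature.Analysis.FluidPDE.BackwardUniquenessRescale
import HarnessLib

/-!
# Seregin 2014, Lemma A.3: the Carleman argument (vanishing above the level sets of `φ_B`)

Analysis/FluidPDE support file (theorems only) in the backward-uniqueness track of **ns.S08**
(`ess_backward_uniqueness`, ESS 2003 Thm. 5.1 = Seregin 2014, Thm. A.3.5). This file carries
out the part of the proof of Lemma A.3 (Seregin 2014, pp. 213–214) between the rescaling and the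
unique continuation: for a function `v` on `]1/2, 3/2[ × {⟪y, e⟫ > 0}` which is `C²`, satisfies
`|∂ₛv + Δv| ≤ c(|v| + |∇v|)` with `c` small, vanishes continuously on `s = 1/2`, has `∂ₛv`
locally square integrable ((A.3.4)), grows at most like `e^{|y|²/48}` together with its gradient
((A.3.9)) and decays like `e^{|y'|²/48} e^{-β'yₙ²}` for `yₙ ≥ Y₀` ((A.3.20)), the second
Carleman inequality with the cut-off of `exists_cutoff_second'` gives, after `θ → 0`
(initial layer), `R' → ∞`, `R'' → ∞` (cut-offs at infinity) and `a → ∞`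
("Passing to the limit as `a → +∞`, we see that `v(y, s) = 0` if `1/2 ≤ s < 1` and
`φ_B(yₙ, s) > 0`"), that `v = 0` where `k(s)ρ(⟪y,e⟫) > B`.

All statements are proved; no definitions.

## References

* G. Seregin, *Lecture notes on regularity theory for the Navier–Stokes equations*, World
  Scientific 2014, App. A.3, proof of Lemma A.3, pp. 213–214. [Seregin2014]
-/

noncomputable section

open MeasureTheory Set Function Filter Metric
open _root_.Topology
open scoped InnerProductSpace RealInnerProductSpace ENNReal

namespace Literature.Analysis.FluidPDE

namespace Carleman

section Vanish

variable {E : Type*} [NormedAddCommGroup E] [InnerProductSpace ℝ E] [FiniteDimensional ℝ E]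
  [MeasurableSpace E] [BorelSpace E]
variable {F : Type*} [NormedAddCommGroup F] [InnerProductSpace ℝ F] [CompleteSpace F]

/-! ### The anisotropic weight `W₂ = s² e^{2φ_a}` -/

omit [FiniteDimensional ℝ E] [MeasurableSpace E] [BorelSpace E] in
/-- `W₂(s, y) = s² e^{-|y'|²/(4s)} e^{2a k(s)ρ(yₙ)}`, `|y'|² = ‖y‖² - ⟪y,e⟫²`. [cite: Seregin2014, App. A.1 Prop. 1.3] -/
theorem weight2_eq (a : ℝ) (e : E) (z : ℝ × E) :
    z.1 ^ 2 * Real.exp (2 * phiKR a (kA (3 / 4)) (rhoA (3 / 4)) e z) =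
      z.1 ^ 2 * Real.exp (-(‖z.2‖ ^ 2 - ⟪z.2, e⟫ ^ 2) / (4 * z.1)) *
        Real.exp (2 * a * (kA (3 / 4) z.1 * rhoA (3 / 4) ⟪z.2, e⟫)) := by
  have h1 : 2 * phi1 e z = -(‖z.2‖ ^ 2 - ⟪z.2, e⟫ ^ 2) / (4 * z.1) := by
    rw [phi1]
    rcases eq_or_ne z.1 0 with h | h
    · rw [h]; simp
    · field_simp
      ring
  rw [phiKR, mul_add, Real.exp_add, h1]
  ring_nf

omit [FiniteDimensional ℝ E] [MeasurableSpace E] [BorelSpace E] in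
/-- Upper bound of the weight for `1/2 ≤ s ≤ 1`: `W₂ ≤ e^{-|y'|²/4} e^{2akρ}` (for a unit
vector `e`, so that `|y'|² ≥ 0`). [folklore] -/
theorem weight2_le {a : ℝ} {e : E} (he : ‖e‖ = 1) {z : ℝ × E} (hz1 : 1 / 2 ≤ z.1) (hz2 : z.1 ≤ 1) :
    z.1 ^ 2 * Real.exp (2 * phiKR a (kA (3 / 4)) (rhoA (3 / 4)) e z) ≤
      Real.exp (-(‖z.2‖ ^ 2 - ⟪z.2, e⟫ ^ 2) / 4) *
        Real.exp (2 * a * (kA (3 / 4) z.1 * rhoA (3 / 4) ⟪z.2, e⟫)) := by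
  rw [weight2_eq]
  have hP := normSq_sub_innerSq_nonneg he z.2
  have hs0 : 0 < z.1 := by linarith
  refine mul_le_mul_of_nonneg_right ?_ (Real.exp_pos _).le
  have h1 : z.1 ^ 2 ≤ 1 := by nlinarith
  have h2 : Real.exp (-(‖z.2‖ ^ 2 - ⟪z.2, e⟫ ^ 2) / (4 * z.1)) ≤
      Real.exp (-(‖z.2‖ ^ 2 - ⟪z.2, e⟫ ^ 2) / 4) := by
    rw [Real.exp_le_exp, neg_div, neg_div, neg_le_neg_iff]
    exact div_le_div_of_nonneg_left hP (by positivity) (by linarith)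
  calc z.1 ^ 2 * Real.exp (-(‖z.2‖ ^ 2 - ⟪z.2, e⟫ ^ 2) / (4 * z.1))
      ≤ 1 * Real.exp (-(‖z.2‖ ^ 2 - ⟪z.2, e⟫ ^ 2) / 4) :=
        mul_le_mul h1 h2 (Real.exp_pos _).le zero_le_one
    _ = _ := one_mul _

omit [FiniteDimensional ℝ E] [MeasurableSpace E] [BorelSpace E] in
/-- Lower bound of the weight for `1/2 ≤ s ≤ 1`: `W₂ ≥ (1/4) e^{-|y'|²/2} e^{2akρ}`. [folklore] -/
theorem weight2_ge {a : ℝ} {e : E} (he : ‖e‖ = 1) {z : ℝ × E} (hz1 : 1 / 2 ≤ z.1) :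
    1 / 4 * Real.exp (-(‖z.2‖ ^ 2 - ⟪z.2, e⟫ ^ 2) / 2) *
        Real.exp (2 * a * (kA (3 / 4) z.1 * rhoA (3 / 4) ⟪z.2, e⟫)) ≤
      z.1 ^ 2 * Real.exp (2 * phiKR a (kA (3 / 4)) (rhoA (3 / 4)) e z) := by
  rw [weight2_eq]
  have hP := normSq_sub_innerSq_nonneg he z.2
  have hs0 : 0 < z.1 := by linarith
  refine mul_le_mul_of_nonneg_right ?_ (Real.exp_pos _).le
  have h1 : (1 / 4 : ℝ) ≤ z.1 ^ 2 := by nlinarith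
  have h2 : Real.exp (-(‖z.2‖ ^ 2 - ⟪z.2, e⟫ ^ 2) / 2) ≤
      Real.exp (-(‖z.2‖ ^ 2 - ⟪z.2, e⟫ ^ 2) / (4 * z.1)) := by
    rw [Real.exp_le_exp, neg_div, neg_div, neg_le_neg_iff]
    exact div_le_div_of_nonneg_left hP (by norm_num) (by linarith)
  exact mul_le_mul h1 h2 (Real.exp_pos _).le (by positivity)

/-! ### Gaussian majorants -/

omit [FiniteDimensional ℝ E] [MeasurableSpace E] [BorelSpace E] in
/-- `(1 + x²)² e^{-bx²} ≤ 2 + 2(2/(eb))²` (`b > 0`). [folklore] -/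
theorem one_add_sq_sq_mul_exp_le {b : ℝ} (hb : 0 < b) (x : ℝ) :
    (1 + x ^ 2) ^ 2 * Real.exp (-(b * x ^ 2)) ≤ 2 + 2 * (2 / (Real.exp 1 * b)) ^ (2 : ℝ) := by
  have he1 : Real.exp (-(b * x ^ 2)) ≤ 1 := by
    rw [Real.exp_le_one_iff]; exact neg_nonpos.2 (by positivity)
  have he0 : 0 < Real.exp (-(b * x ^ 2)) := Real.exp_pos _
  have h4 : x ^ 4 * Real.exp (-(b * x ^ 2)) ≤ (2 / (Real.exp 1 * b)) ^ (2 : ℝ) := by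
    rcases eq_or_ne x 0 with hx | hx
    · have h0 : (0 : ℝ) ^ 4 * Real.exp (-(b * 0 ^ 2)) = 0 := by norm_num
      rw [hx, h0]
      exact Real.rpow_nonneg (by positivity) _
    · have hx2 : 0 < x ^ 2 := by positivity
      have h := rpow_mul_exp_neg_le (p := 2) (by norm_num) hb hx2
      rw [show (x ^ 2) ^ (2 : ℝ) = x ^ 4 by rw [Real.rpow_two]; ring] at h
      exact h
  have h5 : (1 + x ^ 2) ^ 2 ≤ 2 + 2 * x ^ 4 := by nlinarith [sq_nonneg (x ^ 2 - 1)]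
  calc (1 + x ^ 2) ^ 2 * Real.exp (-(b * x ^ 2)) ≤ (2 + 2 * x ^ 4) * Real.exp (-(b * x ^ 2)) :=
        mul_le_mul_of_nonneg_right h5 he0.le
    _ = 2 * Real.exp (-(b * x ^ 2)) + 2 * (x ^ 4 * Real.exp (-(b * x ^ 2))) := by ring
    _ ≤ 2 * 1 + 2 * (2 / (Real.exp 1 * b)) ^ (2 : ℝ) := by gcongr
    _ = _ := by ring

/-- The Gaussian `e^{-δ‖y‖²}` is integrable on `E` (`δ > 0`). [folklore] -/
theorem integrable_exp_neg_mul_norm_sq {δ : ℝ} (hδ : 0 < δ) :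
    Integrable fun y : E => Real.exp (-(δ * ‖y‖ ^ 2)) := by
  have h := integrable_exp_neg_norm_sq_div (E := E)
  -- rescale: `e^{-δ|y|²} = e^{-|c y|²/14}` with `c = √(14 δ)`
  set c : ℝ := Real.sqrt (14 * δ) with hc
  have hc0 : 0 < c := Real.sqrt_pos.2 (by positivity)
  have hc2 : c ^ 2 = 14 * δ := Real.sq_sqrt (by positivity)
  have h2 : Integrable fun y : E => Real.exp (-‖c • y‖ ^ 2 / 14) :=
    h.comp_smul hc0.ne'
  refine h2.congr (ae_of_all _ fun y => ?_)
  simp only [norm_smul, Real.norm_eq_abs, abs_of_pos hc0, mul_pow, hc2]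
  congr 1
  field_simp

/-- The space–time Gaussian majorant `𝟙_{[1/2,1]}(s) e^{-δ‖y‖²}` is integrable on `ℝ × E`. [folklore] -/
theorem integrable_majorant {δ : ℝ} (hδ : 0 < δ) :
    Integrable fun z : ℝ × E =>
      (Icc (1 / 2 : ℝ) 1).indicator (fun _ => (1 : ℝ)) z.1 * Real.exp (-(δ * ‖z.2‖ ^ 2)) := by
  have h1 : Integrable (fun s : ℝ => (Icc (1 / 2 : ℝ) 1).indicator (fun _ => (1 : ℝ)) s) := by
    have : IntegrableOn (fun _ : ℝ => (1 : ℝ)) (Icc (1 / 2 : ℝ) 1) :=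
      integrableOn_const (by rw [Real.volume_Icc]; exact ENNReal.ofReal_ne_top)
    exact this.integrable_indicator measurableSet_Icc
  exact h1.mul_prod (integrable_exp_neg_mul_norm_sq hδ)

/-! ### The tails of the majorant -/

/-- `∫_{⟪y,e⟫ ≥ R} Φ₀ → 0` as `R → ∞`, for an integrable `Φ₀` on `ℝ × E`. [folklore] -/
theorem tendsto_setIntegral_yn_ge {Φ₀ : ℝ × E → ℝ} (hΦ : Integrable Φ₀) (e : E) :
    Tendsto (fun R : ℝ => ∫ z in {z : ℝ × E | R ≤ ⟪z.2, e⟫}, Φ₀ z) atTop (𝓝 0) := by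
  have hsm : ∀ R : ℝ, MeasurableSet {z : ℝ × E | R ≤ ⟪z.2, e⟫} := fun R =>
    measurableSet_le measurable_const (measurable_snd.inner measurable_const)
  have hanti : Antitone fun R : ℝ => {z : ℝ × E | R ≤ ⟪z.2, e⟫} :=
    fun R₁ R₂ h z hz => le_trans h hz
  have h := tendsto_setIntegral_of_antitone hsm hanti ⟨0, hΦ.integrableOn⟩
  have he : (⋂ R : ℝ, {z : ℝ × E | R ≤ ⟪z.2, e⟫}) = ∅ := by
    ext z
    simp only [mem_iInter, mem_setOf_eq, mem_empty_iff_false, iff_false, not_forall, not_le]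
    exact ⟨⟪z.2, e⟫ + 1, by linarith⟩
  rw [he, Measure.restrict_empty, integral_zero_measure] at h
  exact h

/-- `∫_{|y'|² ≥ ρ} Φ₀ → 0` as `ρ → ∞`, for an integrable `Φ₀` on `ℝ × E`. [folklore] -/
theorem tendsto_setIntegral_yprime_ge {Φ₀ : ℝ × E → ℝ} (hΦ : Integrable Φ₀) (e : E) :
    Tendsto (fun ρ : ℝ => ∫ z in {z : ℝ × E | ρ ≤ ‖z.2‖ ^ 2 - ⟪z.2, e⟫ ^ 2}, Φ₀ z) atTop (𝓝 0) := by
  have hsm : ∀ ρ : ℝ, MeasurableSet {z : ℝ × E | ρ ≤ ‖z.2‖ ^ 2 - ⟪z.2, e⟫ ^ 2} := fun ρ =>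
    measurableSet_le measurable_const ((measurable_snd.norm.pow_const 2).sub
      ((measurable_snd.inner measurable_const).pow_const 2))
  have hanti : Antitone fun ρ : ℝ => {z : ℝ × E | ρ ≤ ‖z.2‖ ^ 2 - ⟪z.2, e⟫ ^ 2} :=
    fun ρ₁ ρ₂ h z hz => le_trans h hz
  have h := tendsto_setIntegral_of_antitone hsm hanti ⟨0, hΦ.integrableOn⟩
  have he : (⋂ ρ : ℝ, {z : ℝ × E | ρ ≤ ‖z.2‖ ^ 2 - ⟪z.2, e⟫ ^ 2}) = ∅ := by
    ext z
    simp only [mem_iInter, mem_setOf_eq, mem_empty_iff_false, iff_false, not_forall, not_le]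
    exact ⟨‖z.2‖ ^ 2 - ⟪z.2, e⟫ ^ 2 + 1, by linarith⟩
  rw [he, Measure.restrict_empty, integral_zero_measure] at h
  exact h

/-! ### Pointwise majorants of the weighted error integrands -/

omit [MeasurableSpace E] [BorelSpace E] [CompleteSpace F] in
/-- **Pointwise majorant from the decay (A.3.20).** If `|v| + |∇v| ≤ C_d e^{|y'|²/48} e^{-β'yₙ²}`
at `z` (`0 < β' ≤ 1/8`) and `X ≤ e^{β'yₙ²/2}`, then
`X e^{-|y'|²/4} (1 + yₙ²)² (|v|² + |∇v|²) ≤ C_d² C_β e^{-β'‖y‖²/2}`,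
`C_β = 2 + 2(4/(eβ'))²`. [cite: Seregin2014, App. A.3, proof of Lemma A.3] -/
theorem majorant_of_decay {v : ℝ × E → F} {e : E} (he : ‖e‖ = 1) {Cd β' X : ℝ}
    (hβ' : 0 < β') (hβ'8 : β' ≤ 1 / 8) {z : ℝ × E}
    (hX : X ≤ Real.exp (β' / 2 * ⟪z.2, e⟫ ^ 2))
    (hb : ‖v z‖ + Real.sqrt (gradSq v z) ≤
      Cd * Real.exp ((‖z.2‖ ^ 2 - ⟪z.2, e⟫ ^ 2) / 48) * Real.exp (-(β' * ⟪z.2, e⟫ ^ 2))) :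
    X * (Real.exp (-(‖z.2‖ ^ 2 - ⟪z.2, e⟫ ^ 2) / 4) *
        ((1 + ⟪z.2, e⟫ ^ 2) ^ 2 * (‖v z‖ ^ 2 + gradSq v z))) ≤
      Cd ^ 2 * (2 + 2 * (2 / (Real.exp 1 * (β' / 2))) ^ (2 : ℝ)) *
        Real.exp (-(β' / 2 * ‖z.2‖ ^ 2)) := by
  set P : ℝ := ‖z.2‖ ^ 2 - ⟪z.2, e⟫ ^ 2 with hP
  set r : ℝ := ⟪z.2, e⟫ with hr
  have hP0 : 0 ≤ P := normSq_sub_innerSq_nonneg he z.2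
  set Cβ : ℝ := 2 + 2 * (2 / (Real.exp 1 * (β' / 2))) ^ (2 : ℝ) with hCβ
  have hCβ0 : 0 ≤ Cβ := by positivity
  -- `|v|² + |∇v|² ≤ (|v| + |∇v|)² ≤ C_d² e^{P/24} e^{-2β'r²}`
  have hg0 := gradSq_nonneg v z
  have h1 : ‖v z‖ ^ 2 + gradSq v z ≤ (‖v z‖ + Real.sqrt (gradSq v z)) ^ 2 := by
    have hs := Real.sq_sqrt hg0
    nlinarith [norm_nonneg (v z), Real.sqrt_nonneg (gradSq v z)]
  have h2 : (‖v z‖ + Real.sqrt (gradSq v z)) ^ 2 ≤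
      (Cd * Real.exp (P / 48) * Real.exp (-(β' * r ^ 2))) ^ 2 :=
    pow_le_pow_left₀ (by positivity) hb 2
  have h3 : (Cd * Real.exp (P / 48) * Real.exp (-(β' * r ^ 2))) ^ 2 =
      Cd ^ 2 * Real.exp (P / 24) * Real.exp (-(2 * β' * r ^ 2)) := by
    rw [mul_pow, mul_pow, ← Real.exp_nat_mul, ← Real.exp_nat_mul]
    congr 2 <;> (congr 1; push_cast; ring)
  have hvg : ‖v z‖ ^ 2 + gradSq v z ≤ Cd ^ 2 * Real.exp (P / 24) * Real.exp (-(2 * β' * r ^ 2)) := by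
    rw [← h3]; exact h1.trans h2
  -- the polynomial
  have hpoly : (1 + r ^ 2) ^ 2 * Real.exp (-(β' / 2 * r ^ 2)) ≤ Cβ :=
    one_add_sq_sq_mul_exp_le (by positivity) r
  -- the exponentials: `e^{β'r²/2} e^{-P/4} e^{P/24} e^{-2β'r²} = e^{-(5/24)P} e^{-β'r²/2} e^{-β' r²}`
  have hexp : Real.exp (β' / 2 * r ^ 2) * Real.exp (-P / 4) * Real.exp (P / 24) *
      Real.exp (-(2 * β' * r ^ 2)) =
      Real.exp (-(5 / 24 * P)) * Real.exp (-(β' / 2 * r ^ 2)) * Real.exp (-(β' * r ^ 2)) := by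
    rw [← Real.exp_add, ← Real.exp_add, ← Real.exp_add, ← Real.exp_add, ← Real.exp_add]
    congr 1; ring
  have hfin : Real.exp (-(5 / 24 * P)) * Real.exp (-(β' * r ^ 2)) ≤ Real.exp (-(β' / 2 * ‖z.2‖ ^ 2)) := by
    rw [← Real.exp_add, Real.exp_le_exp]
    have : ‖z.2‖ ^ 2 = P + r ^ 2 := by rw [hP, hr]; ring
    rw [this]
    nlinarith
  -- assemble
  have hL0 : 0 ≤ Real.exp (-P / 4) * ((1 + r ^ 2) ^ 2 * (‖v z‖ ^ 2 + gradSq v z)) := by positivity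
  calc X * (Real.exp (-P / 4) * ((1 + r ^ 2) ^ 2 * (‖v z‖ ^ 2 + gradSq v z)))
      ≤ Real.exp (β' / 2 * r ^ 2) * (Real.exp (-P / 4) * ((1 + r ^ 2) ^ 2 *
          (Cd ^ 2 * Real.exp (P / 24) * Real.exp (-(2 * β' * r ^ 2))))) := by
        refine mul_le_mul hX ?_ hL0 (Real.exp_pos _).le
        exact mul_le_mul_of_nonneg_left (mul_le_mul_of_nonneg_left hvg (sq_nonneg _))
          (Real.exp_pos _).le
    _ = Cd ^ 2 * ((1 + r ^ 2) ^ 2 * Real.exp (-(β' / 2 * r ^ 2))) *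
          (Real.exp (-(5 / 24 * P)) * Real.exp (-(β' * r ^ 2))) := by
        rw [show Real.exp (β' / 2 * r ^ 2) * (Real.exp (-P / 4) * ((1 + r ^ 2) ^ 2 *
          (Cd ^ 2 * Real.exp (P / 24) * Real.exp (-(2 * β' * r ^ 2))))) =
          Cd ^ 2 * (1 + r ^ 2) ^ 2 * (Real.exp (β' / 2 * r ^ 2) * Real.exp (-P / 4) *
            Real.exp (P / 24) * Real.exp (-(2 * β' * r ^ 2))) by ring, hexp]
        ring
    _ ≤ Cd ^ 2 * Cβ * Real.exp (-(β' / 2 * ‖z.2‖ ^ 2)) := by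
        refine mul_le_mul (mul_le_mul_of_nonneg_left hpoly (sq_nonneg _)) hfin (by positivity)
          (by positivity)

omit [MeasurableSpace E] [BorelSpace E] [CompleteSpace F] in
/-- **Pointwise majorant from the growth bound (A.3.9)** (used on the shell `|y'| ≥ R'`): if
`|v| + |∇v| ≤ C_g e^{‖y‖²/48}` at `z`, `yₙ = ⟪y, e⟫ ∈ [0, R]` and `0 ≤ X ≤ e^{T}`, then
`X e^{-|y'|²/4}(1 + yₙ²)²(|v|² + |∇v|²) ≤ C_g²(1 + R²)² e^{T + R²/2} e^{-‖y‖²/8}`. [folklore] -/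
theorem majorant_of_growth {v : ℝ × E → F} {e : E} {Cg X T R : ℝ}
    (hX : X ≤ Real.exp T) {z : ℝ × E} (hr0 : 0 ≤ ⟪z.2, e⟫) (hrR : ⟪z.2, e⟫ ≤ R)
    (hb : ‖v z‖ + Real.sqrt (gradSq v z) ≤ Cg * Real.exp (‖z.2‖ ^ 2 / 48)) :
    X * (Real.exp (-(‖z.2‖ ^ 2 - ⟪z.2, e⟫ ^ 2) / 4) *
        ((1 + ⟪z.2, e⟫ ^ 2) ^ 2 * (‖v z‖ ^ 2 + gradSq v z))) ≤
      Cg ^ 2 * (1 + R ^ 2) ^ 2 * Real.exp (T + R ^ 2 / 2) * Real.exp (-(‖z.2‖ ^ 2 / 8)) := by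
  set r : ℝ := ⟪z.2, e⟫ with hr
  have hg0 := gradSq_nonneg v z
  have h1 : ‖v z‖ ^ 2 + gradSq v z ≤ (‖v z‖ + Real.sqrt (gradSq v z)) ^ 2 := by
    have hs := Real.sq_sqrt hg0
    nlinarith [norm_nonneg (v z), Real.sqrt_nonneg (gradSq v z)]
  have h2 : (‖v z‖ + Real.sqrt (gradSq v z)) ^ 2 ≤ (Cg * Real.exp (‖z.2‖ ^ 2 / 48)) ^ 2 :=
    pow_le_pow_left₀ (by positivity) hb 2
  have h3 : (Cg * Real.exp (‖z.2‖ ^ 2 / 48)) ^ 2 = Cg ^ 2 * Real.exp (‖z.2‖ ^ 2 / 24) := by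
    rw [mul_pow, ← Real.exp_nat_mul]; congr 2; push_cast; ring
  have hvg : ‖v z‖ ^ 2 + gradSq v z ≤ Cg ^ 2 * Real.exp (‖z.2‖ ^ 2 / 24) := by
    rw [← h3]; exact h1.trans h2
  have hq : (1 + r ^ 2) ^ 2 ≤ (1 + R ^ 2) ^ 2 := by
    have : r ^ 2 ≤ R ^ 2 := pow_le_pow_left₀ hr0 hrR 2
    nlinarith
  have hexp : Real.exp T * Real.exp (-(‖z.2‖ ^ 2 - r ^ 2) / 4) * Real.exp (‖z.2‖ ^ 2 / 24) ≤
      Real.exp (T + R ^ 2 / 2) * Real.exp (-(‖z.2‖ ^ 2 / 8)) := by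
    rw [← Real.exp_add, ← Real.exp_add, ← Real.exp_add, Real.exp_le_exp]
    have : r ^ 2 ≤ R ^ 2 := pow_le_pow_left₀ hr0 hrR 2
    nlinarith [sq_nonneg ‖z.2‖]
  have hL0 : 0 ≤ Real.exp (-(‖z.2‖ ^ 2 - r ^ 2) / 4) * ((1 + r ^ 2) ^ 2 * (‖v z‖ ^ 2 + gradSq v z)) := by
    positivity
  calc X * (Real.exp (-(‖z.2‖ ^ 2 - r ^ 2) / 4) * ((1 + r ^ 2) ^ 2 * (‖v z‖ ^ 2 + gradSq v z)))
      ≤ Real.exp T * (Real.exp (-(‖z.2‖ ^ 2 - r ^ 2) / 4) *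
          ((1 + R ^ 2) ^ 2 * (Cg ^ 2 * Real.exp (‖z.2‖ ^ 2 / 24)))) := by
        refine mul_le_mul hX ?_ hL0 (Real.exp_pos _).le
        exact mul_le_mul_of_nonneg_left (mul_le_mul hq hvg (by positivity) (by positivity))
          (Real.exp_pos _).le
    _ = Cg ^ 2 * (1 + R ^ 2) ^ 2 * (Real.exp T * Real.exp (-(‖z.2‖ ^ 2 - r ^ 2) / 4) *
          Real.exp (‖z.2‖ ^ 2 / 24)) := by ring
    _ ≤ Cg ^ 2 * (1 + R ^ 2) ^ 2 * (Real.exp (T + R ^ 2 / 2) * Real.exp (-(‖z.2‖ ^ 2 / 8))) :=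
        mul_le_mul_of_nonneg_left hexp (by positivity)
    _ = _ := by ring

/-! ### Elementary facts on `k(s)ρ(yₙ)` -/

omit [FiniteDimensional ℝ E] [MeasurableSpace E] [BorelSpace E] in
/-- `k(s)ρ(r) ≤ r²` for `1/2 ≤ s ≤ 1`, `r ≥ 1`. [folklore] -/
theorem krho_le_sq {s r : ℝ} (hs : 1 / 2 ≤ s) (hs1 : s ≤ 1) (hr : 1 ≤ r) :
    kA (3 / 4) s * rhoA (3 / 4) r ≤ r ^ 2 := by
  obtain ⟨hk0, hk1⟩ := kA_mem_Icc hs hs1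
  have hρ := rhoA_le_sq hr
  have hρ0 := rhoA_nonneg (by linarith : (0 : ℝ) ≤ r)
  calc kA (3 / 4) s * rhoA (3 / 4) r ≤ 1 * r ^ 2 := mul_le_mul hk1 hρ hρ0 zero_le_one
    _ = r ^ 2 := one_mul _

omit [FiniteDimensional ℝ E] [MeasurableSpace E] [BorelSpace E] in
/-- If `k(s)ρ(r) ≥ (Y + 1)²` (`1/2 ≤ s ≤ 1`, `r ≥ 1`, `Y ≥ 0`), then `r ≥ Y + 1`. [folklore] -/
theorem yn_ge_of_krho_ge {s r Y : ℝ} (hs : 1 / 2 ≤ s) (hs1 : s ≤ 1) (hr : 1 ≤ r) (hY : 0 ≤ Y)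
    (h : (Y + 1) ^ 2 ≤ kA (3 / 4) s * rhoA (3 / 4) r) : Y + 1 ≤ r := by
  have h1 := h.trans (krho_le_sq hs hs1 hr)
  nlinarith

omit [FiniteDimensional ℝ E] [MeasurableSpace E] [BorelSpace E] in
/-- For `r ≥ (4a/β')²` (`r ≥ 1`, `a ≥ 0`, `β' > 0`, `1/2 ≤ s ≤ 1`):
`e^{2a k(s)ρ(r)} ≤ e^{β' r²/2}` (`k ρ ≤ r^{3/2}` and `2a r^{3/2} ≤ (β'/2) r²`). [folklore] -/
theorem exp_krho_le_of_large {s r a β' : ℝ} (hs : 1 / 2 ≤ s) (hs1 : s ≤ 1) (hr : 1 ≤ r)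
    (ha : 0 ≤ a) (hβ' : 0 < β') (hra : (4 * a / β') ^ 2 ≤ r) :
    Real.exp (2 * a * (kA (3 / 4) s * rhoA (3 / 4) r)) ≤ Real.exp (β' / 2 * r ^ 2) := by
  rw [Real.exp_le_exp]
  have hr0 : 0 ≤ r := by linarith
  obtain ⟨hk0, hk1⟩ := kA_mem_Icc hs hs1
  have hρ0 := rhoA_nonneg hr0
  have h1 : kA (3 / 4) s * rhoA (3 / 4) r ≤ rhoA (3 / 4) r := by
    calc kA (3 / 4) s * rhoA (3 / 4) r ≤ 1 * rhoA (3 / 4) r := mul_le_mul_of_nonneg_right hk1 hρ0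
      _ = _ := one_mul _
  -- `ρ(r) = r √r` and `√r ≥ 4a/β'`
  have hρ : rhoA (3 / 4) r = r * Real.sqrt r := by
    rw [rhoA, show (2 : ℝ) * (3 / 4) = 1 + 1 / 2 by norm_num, Real.rpow_add (by linarith),
      Real.rpow_one, Real.sqrt_eq_rpow]
  have hsq : 4 * a / β' ≤ Real.sqrt r := by
    rw [Real.le_sqrt (by positivity) hr0]; exact hra
  have h2 : 2 * a * rhoA (3 / 4) r ≤ β' / 2 * r ^ 2 := by
    rw [hρ]
    have h3 : 2 * a ≤ β' / 2 * Real.sqrt r := by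
      rw [div_le_iff₀ hβ'] at hsq
      linarith
    have h4 := mul_le_mul_of_nonneg_right h3 (by positivity : 0 ≤ r * Real.sqrt r)
    have h5 : β' / 2 * Real.sqrt r * (r * Real.sqrt r) = β' / 2 * r ^ 2 := by
      have := Real.mul_self_sqrt hr0
      rw [show β' / 2 * Real.sqrt r * (r * Real.sqrt r) = β' / 2 * r * (Real.sqrt r * Real.sqrt r)
        by ring, this]
      ring
    linarith
  nlinarith [mul_le_mul_of_nonneg_left h1 (by linarith : 0 ≤ 2 * a)]

/-! ### The core estimate -/

set_option maxHeartbeats 1600000 in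
/-- **The core of the proof of Lemma A.3** (Seregin 2014, pp. 213–214). Let `v` be `C²` on
`O = ]1/2, 3/2[ × {⟪y,e⟫ > 0}` with `|∂ₛv + Δv| ≤ c(|v| + |∇v|)`, `c² ≤ 1/264`, continuous on
`[1/2, 1] × {⟪y,e⟫ > 0}` with `v(1/2, ·) = 0`, `∂ₛv` square integrable on bounded measurable
subsets of `O`, `|v| + |∇v| ≤ C_g e^{|y|²/48}` for `s < 1`, `yₙ > 1` ((A.3.9)) and
`|v| + |∇v| ≤ C_d e^{|y'|²/48} e^{-β'yₙ²}` for `s < 1`, `yₙ ≥ Y₀` ((A.3.20)). Let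
`B = 4(Y₀+1)² + 8`. Then for `a ≥ 2`, `0 < σ ≤ 1/4`, `R₁ ≥ 1`, on
`G = {1/2 + σ ≤ s ≤ 1, 1 ≤ yₙ ≤ R₁, |y'|² ≤ R₁², kρ ≥ B}` we have
`∫_G W₂|v|² ≤ C_η (264 (e^{aB} K_M + 2) + 66)`, `K_M = C_d² C_β ∫ 𝟙_{[1/2,1]}(s)e^{-β'|y|²/2}`,
with `C_η` the constant of `exists_cutoff_second'` (the three cut-off error terms at infinity
and in the initial layer being made `≤ 1` by the choice of `R''`, `R'`, `θ`). [cite: Seregin2014, App. A.3, proof of Lemma A.3] -/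
theorem vanish_core {v : ℝ × E → F} {e : E} {c Cg Cd β' Y₀ Cη : ℝ} (he : ‖e‖ = 1)
    (hc : c ^ 2 ≤ 1 / (24 * 11)) (hβ' : 0 < β') (hβ'8 : β' ≤ 1 / 8)
    (hY₀ : 1 ≤ Y₀) (hCη : 0 < Cη)
    (hηex : ∀ (B θ R' R'' : ℝ), 8 ≤ B → 0 < θ → θ ≤ 1 / 8 → 1 ≤ R' → 2 ≤ R'' →
      ∃ η : ℝ × E → ℝ, ContDiff ℝ 2 η ∧ HasCompactSupport η ∧
      tsupport η ⊆ Icc (1 / 2 + θ) (1 - B / (8 * (R'' + 1) ^ 2)) ×ˢ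
        {y : E | 3 / 2 ≤ ⟪y, e⟫ ∧ ⟪y, e⟫ ≤ R'' + 1 ∧ ‖y‖ ^ 2 - ⟪y, e⟫ ^ 2 ≤ (R' + 1) ^ 2} ∧
      (∀ z, 0 ≤ η z) ∧ (∀ z, η z ≤ 1) ∧
      (∀ z : ℝ × E, 1 / 2 + 2 * θ ≤ z.1 → 1 ≤ ⟪z.2, e⟫ → ⟪z.2, e⟫ ≤ R'' →
        B / 2 ≤ kA (3 / 4) z.1 * rhoA (3 / 4) ⟪z.2, e⟫ → ‖z.2‖ ^ 2 - ⟪z.2, e⟫ ^ 2 ≤ R' ^ 2 →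
        η z = 1) ∧
      (∀ z : ℝ × E, (dt η z + lap η z) ^ 2 ≤
        Cη * (θ⁻¹ ^ 2 * (Icc (1 / 2 + θ) (1 / 2 + 2 * θ)).indicator (fun _ => (1 : ℝ)) z.1 +
          (1 + ⟪z.2, e⟫ ^ 2) ^ 2 *
            ({z : ℝ × E | 0 < z.1 ∧ 0 < ⟪z.2, e⟫ ∧
                kA (3 / 4) z.1 * rhoA (3 / 4) ⟪z.2, e⟫ ∈ Icc (B / 4) (B / 2)}.indicator
                (fun _ => (1 : ℝ)) z +
              (Icc R'' (R'' + 1)).indicator (fun _ => (1 : ℝ)) ⟪z.2, e⟫ +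
              (Icc (R' ^ 2) ((R' + 1) ^ 2)).indicator (fun _ => (1 : ℝ))
                (‖z.2‖ ^ 2 - ⟪z.2, e⟫ ^ 2)))) ∧
      (∀ z : ℝ × E, gradSq η z ≤
        Cη * ((1 + ⟪z.2, e⟫ ^ 2) ^ 2 *
            ({z : ℝ × E | 0 < z.1 ∧ 0 < ⟪z.2, e⟫ ∧
                kA (3 / 4) z.1 * rhoA (3 / 4) ⟪z.2, e⟫ ∈ Icc (B / 4) (B / 2)}.indicator
                (fun _ => (1 : ℝ)) z +
              (Icc R'' (R'' + 1)).indicator (fun _ => (1 : ℝ)) ⟪z.2, e⟫ +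
              (Icc (R' ^ 2) ((R' + 1) ^ 2)).indicator (fun _ => (1 : ℝ))
                (‖z.2‖ ^ 2 - ⟪z.2, e⟫ ^ 2)))))
    (hv : ContDiffOn ℝ 2 v (Ioo (1 / 2 : ℝ) (3 / 2) ×ˢ {y : E | 0 < ⟪y, e⟫}))
    (hBH : ∀ z ∈ Ioo (1 / 2 : ℝ) (3 / 2) ×ˢ {y : E | 0 < ⟪y, e⟫},
      ‖dt v z + lap v z‖ ≤ c * (‖v z‖ + Real.sqrt (gradSq v z)))
    (hcont : ContinuousOn v (Icc (1 / 2 : ℝ) 1 ×ˢ {y : E | 0 < ⟪y, e⟫}))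
    (h0 : ∀ y : E, 0 < ⟪y, e⟫ → v (1 / 2, y) = 0)
    (hH3 : ∀ K ⊆ Ioo (1 / 2 : ℝ) (3 / 2) ×ˢ {y : E | 0 < ⟪y, e⟫}, Bornology.IsBounded K →
      MeasurableSet K → ∫⁻ z in K, ‖dt v z‖ₑ ^ 2 < ∞)
    (hgr : ∀ z ∈ Ioo (1 / 2 : ℝ) (3 / 2) ×ˢ {y : E | 0 < ⟪y, e⟫}, z.1 < 1 → 1 < ⟪z.2, e⟫ →
      ‖v z‖ + Real.sqrt (gradSq v z) ≤ Cg * Real.exp (‖z.2‖ ^ 2 / 48))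
    (hdec : ∀ z ∈ Ioo (1 / 2 : ℝ) (3 / 2) ×ˢ {y : E | 0 < ⟪y, e⟫}, z.1 < 1 → Y₀ ≤ ⟪z.2, e⟫ →
      ‖v z‖ + Real.sqrt (gradSq v z) ≤
        Cd * Real.exp ((‖z.2‖ ^ 2 - ⟪z.2, e⟫ ^ 2) / 48) * Real.exp (-(β' * ⟪z.2, e⟫ ^ 2)))
    {a σ R₁ : ℝ} (ha : 2 ≤ a) (hσ : 0 < σ) (hσ1 : σ ≤ 1 / 4) (hR₁ : 1 ≤ R₁) :
    ∫ z in {z : ℝ × E | 1 / 2 + σ ≤ z.1 ∧ z.1 ≤ 1 ∧ 1 ≤ ⟪z.2, e⟫ ∧ ⟪z.2, e⟫ ≤ R₁ ∧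
        ‖z.2‖ ^ 2 - ⟪z.2, e⟫ ^ 2 ≤ R₁ ^ 2 ∧
        4 * (Y₀ + 1) ^ 2 + 8 ≤ kA (3 / 4) z.1 * rhoA (3 / 4) ⟪z.2, e⟫},
      z.1 ^ 2 * Real.exp (2 * phiKR a (kA (3 / 4)) (rhoA (3 / 4)) e z) * ‖v z‖ ^ 2 ≤
      Cη * (331 * (Real.exp (a * (4 * (Y₀ + 1) ^ 2 + 8)) *
        (Cd ^ 2 * (2 + 2 * (2 / (Real.exp 1 * (β' / 2))) ^ (2 : ℝ)) *
          ∫ z : ℝ × E, (Icc (1 / 2 : ℝ) 1).indicator (fun _ => (1 : ℝ)) z.1 *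
            Real.exp (-(β' / 2 * ‖z.2‖ ^ 2))) + 2) + 66) := by
  -- ### the sets and constants
  set H : Set E := {y : E | 0 < ⟪y, e⟫} with hH
  set O : Set (ℝ × E) := Ioo (1 / 2 : ℝ) (3 / 2) ×ˢ H with hO
  have hHo : IsOpen H := isOpen_lt continuous_const (continuous_id.inner continuous_const)
  have hOo : IsOpen O := isOpen_Ioo.prod hHo
  obtain ⟨B, hBdef⟩ : ∃ B : ℝ, B = 4 * (Y₀ + 1) ^ 2 + 8 := ⟨_, rfl⟩
  have hB8 : 8 ≤ B := by rw [hBdef]; nlinarith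
  have hBY : (Y₀ + 1) ^ 2 ≤ B / 4 := by rw [hBdef]; linarith
  have hB0 : 0 ≤ B := by linarith
  obtain ⟨Cβ, hCβ⟩ : ∃ Cβ : ℝ, Cβ = 2 + 2 * (2 / (Real.exp 1 * (β' / 2))) ^ (2 : ℝ) := ⟨_, rfl⟩
  have hCβ0 : 0 ≤ Cβ := by rw [hCβ]; positivity
  set Φβ : ℝ × E → ℝ := fun z => (Icc (1 / 2 : ℝ) 1).indicator (fun _ => (1 : ℝ)) z.1 *
    Real.exp (-(β' / 2 * ‖z.2‖ ^ 2)) with hΦβ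
  have hΦβi : Integrable Φβ := integrable_majorant (by positivity)
  have hind01 : ∀ (T : Set ℝ) (x : ℝ), 0 ≤ T.indicator (fun _ => (1 : ℝ)) x ∧
      T.indicator (fun _ => (1 : ℝ)) x ≤ 1 := fun T x => by
    by_cases hx : x ∈ T
    · rw [Set.indicator_of_mem hx]; norm_num
    · rw [Set.indicator_of_notMem hx]; norm_num
  have hΦβ0 : ∀ z, 0 ≤ Φβ z := fun z => mul_nonneg (hind01 _ _).1 (Real.exp_pos _).le
  set Φ₈ : ℝ × E → ℝ := fun z => (Icc (1 / 2 : ℝ) 1).indicator (fun _ => (1 : ℝ)) z.1 *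
    Real.exp (-(1 / 8 * ‖z.2‖ ^ 2)) with hΦ₈
  have hΦ₈i : Integrable Φ₈ := integrable_majorant (by norm_num)
  have hΦ₈0 : ∀ z, 0 ≤ Φ₈ z := fun z => mul_nonneg (hind01 _ _).1 (Real.exp_pos _).le
  set KM : ℝ := Cd ^ 2 * Cβ * ∫ z, Φβ z with hKM
  have hIΦβ0 : 0 ≤ ∫ z, Φβ z := integral_nonneg hΦβ0
  have hKM0 : 0 ≤ KM := by positivity
  have ha0 : 0 ≤ a := by linarith
  -- ### the choice of `R''`
  have hlimN := ((tendsto_setIntegral_yn_ge hΦβi e).const_mul (Cd ^ 2 * Cβ))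
  rw [mul_zero] at hlimN
  obtain ⟨RN, hRN⟩ := eventually_atTop.1 (hlimN.eventually_le_const zero_lt_one)
  set R'' : ℝ := max (max (max R₁ (Y₀ + 1)) ((4 * a / β') ^ 2)) (max RN 2) with hR''
  have hR''R₁ : R₁ ≤ R'' := le_trans (le_trans (le_max_left _ _) (le_max_left _ _)) (le_max_left _ _)
  have hR''Y : Y₀ + 1 ≤ R'' := le_trans (le_trans (le_max_right _ _) (le_max_left _ _)) (le_max_left _ _)
  have hR''a : (4 * a / β') ^ 2 ≤ R'' := le_trans (le_max_right _ _) (le_max_left _ _)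
  have hR''N : RN ≤ R'' := le_trans (le_max_left _ _) (le_max_right _ _)
  have hR''2 : 2 ≤ R'' := le_trans (le_max_right _ _) (le_max_right _ _)
  have hTN1 : Cd ^ 2 * Cβ * ∫ z in {z : ℝ × E | R'' ≤ ⟪z.2, e⟫}, Φβ z ≤ 1 := hRN R'' hR''N
  -- ### the choice of `R'`
  set KSh : ℝ := Cg ^ 2 * (1 + (R'' + 1) ^ 2) ^ 2 *
    Real.exp (2 * a * (R'' + 1) ^ 2 + (R'' + 1) ^ 2 / 2) with hKSh
  have hKSh0 : 0 ≤ KSh := by positivity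
  have hlimSh := ((tendsto_setIntegral_yprime_ge hΦ₈i e).const_mul KSh)
  rw [mul_zero] at hlimSh
  obtain ⟨ρ₀, hρ₀⟩ := eventually_atTop.1 (hlimSh.eventually_le_const zero_lt_one)
  set R' : ℝ := max (max R₁ 1) (Real.sqrt (max ρ₀ 0)) with hR'
  have hR'R₁ : R₁ ≤ R' := le_trans (le_max_left _ _) (le_max_left _ _)
  have hR'1 : 1 ≤ R' := le_trans (le_max_right _ _) (le_max_left _ _)
  have hR'ρ : ρ₀ ≤ R' ^ 2 := by
    have h1 : Real.sqrt (max ρ₀ 0) ≤ R' := le_max_right _ _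
    have h2 : Real.sqrt (max ρ₀ 0) ^ 2 = max ρ₀ 0 := Real.sq_sqrt (le_max_right _ _)
    have h3 := pow_le_pow_left₀ (Real.sqrt_nonneg _) h1 2
    rw [h2] at h3
    exact le_trans (le_max_left _ _) h3
  have hTSh1 : KSh * ∫ z in {z : ℝ × E | R' ^ 2 ≤ ‖z.2‖ ^ 2 - ⟪z.2, e⟫ ^ 2}, Φ₈ z ≤ 1 :=
    hρ₀ _ hR'ρ
  -- ### the spatial base of the box and the weight bound there
  set Bset : Set E := {y : E | 3 / 2 ≤ ⟪y, e⟫ ∧ ⟪y, e⟫ ≤ R'' + 1 ∧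
    ‖y‖ ^ 2 - ⟪y, e⟫ ^ 2 ≤ (R' + 1) ^ 2} with hBset
  have hce : Continuous fun y : E => ⟪y, e⟫ := continuous_id.inner continuous_const
  have hcP : Continuous fun y : E => ‖y‖ ^ 2 - ⟪y, e⟫ ^ 2 := (continuous_norm.pow 2).sub (hce.pow 2)
  have hBsetc : IsClosed Bset := (isClosed_le continuous_const hce).inter
    ((isClosed_le hce continuous_const).inter (isClosed_le hcP continuous_const))
  have hBsetm : MeasurableSet Bset := hBsetc.measurableSet
  have hBsetK : Bset ⊆ closedBall (0 : E) (R' + R'' + 2) := by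
    intro y hy
    rw [mem_closedBall, dist_zero_right]
    obtain ⟨h1, h2, h3⟩ := hy
    have h4 : ‖y‖ ^ 2 ≤ (R' + R'' + 2) ^ 2 := by nlinarith
    nlinarith [norm_nonneg y]
  have hBsetb : Bornology.IsBounded Bset := isBounded_closedBall.subset hBsetK
  have hBsetcpt : IsCompact Bset := (isCompact_closedBall _ _).of_isClosed_subset hBsetc hBsetK
  have hBsetvol : volume Bset ≠ ∞ := (measure_mono hBsetK |>.trans_lt measure_closedBall_lt_top).ne
  have hBsetH : Bset ⊆ H := fun y hy => by
    show 0 < ⟪y, e⟫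
    linarith [hy.1]
  set Wmax : ℝ := Real.exp (2 * a * (R'' + 1) ^ 2) with hWmax
  have hWmax0 : 0 < Wmax := Real.exp_pos _
  have hWle : ∀ z : ℝ × E, 1 / 2 ≤ z.1 → z.1 ≤ 1 → 1 ≤ ⟪z.2, e⟫ → ⟪z.2, e⟫ ≤ R'' + 1 →
      z.1 ^ 2 * Real.exp (2 * phiKR a (kA (3 / 4)) (rhoA (3 / 4)) e z) ≤ Wmax := by
    intro z hz1 hz2 hr1 hr2
    refine (weight2_le he hz1 hz2).trans ?_
    have hP := normSq_sub_innerSq_nonneg he z.2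
    have h1 : Real.exp (-(‖z.2‖ ^ 2 - ⟪z.2, e⟫ ^ 2) / 4) ≤ 1 := by
      rw [Real.exp_le_one_iff, neg_div]; exact neg_nonpos.2 (by positivity)
    have h2 : Real.exp (2 * a * (kA (3 / 4) z.1 * rhoA (3 / 4) ⟪z.2, e⟫)) ≤ Wmax := by
      rw [hWmax, Real.exp_le_exp]
      have h3 := krho_le_sq hz1 hz2 hr1
      have h4 : ⟪z.2, e⟫ ^ 2 ≤ (R'' + 1) ^ 2 := pow_le_pow_left₀ (by linarith) hr2 2
      exact mul_le_mul_of_nonneg_left (h3.trans h4) (by linarith)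
    calc Real.exp (-(‖z.2‖ ^ 2 - ⟪z.2, e⟫ ^ 2) / 4) *
        Real.exp (2 * a * (kA (3 / 4) z.1 * rhoA (3 / 4) ⟪z.2, e⟫)) ≤ 1 * Wmax :=
          mul_le_mul h1 h2 (Real.exp_pos _).le zero_le_one
      _ = Wmax := one_mul _
  -- ### the choice of `θ` (the initial layer)
  have hvC1 : ContDiffOn ℝ 1 v O := hv.of_le (by norm_num)
  have hsubO : Ioo (1 / 2 : ℝ) (1 / 2 + 1 / 2) ×ˢ Bset ⊆ O := by
    rw [show (1 / 2 : ℝ) + 1 / 2 = 1 by norm_num]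
    exact Set.prod_mono (Ioo_subset_Ioo_right (by norm_num)) hBsetH
  have hcontL : ContinuousOn v (Ico (1 / 2 : ℝ) (1 / 2 + 1 / 2) ×ˢ Bset) := by
    rw [show (1 / 2 : ℝ) + 1 / 2 = 1 by norm_num]
    exact hcont.mono (Set.prod_mono Ico_subset_Icc_self hBsetH)
  have h0L : ∀ y ∈ Bset, v (1 / 2, y) = 0 := fun y hy => h0 y (hBsetH hy)
  have hfinL : ∫⁻ z in Ioo (1 / 2 : ℝ) (1 / 2 + 1 / 2) ×ˢ Bset, ‖dt v z‖ₑ ^ 2 < ∞ :=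
    hH3 _ hsubO ((Metric.isBounded_Ioo _ _).prod hBsetb) (measurableSet_Ioo.prod hBsetm)
  have hε₁ : (0 : ℝ) < 1 / (9 * Wmax + 1) := by positivity
  obtain ⟨θ₀, hθ₀, hlayer⟩ := exists_layer_integral_le hOo hvC1 hsubO hcontL h0L hBsetm hBsetvol
    (by norm_num : (0 : ℝ) < 1 / 2) hfinL hε₁
  set θ : ℝ := min (θ₀ / 3) (min (σ / 2) (1 / 8)) with hθ
  have hθ0 : 0 < θ := lt_min (by linarith [hθ₀.1]) (lt_min (by linarith) (by norm_num))
  have hθ3 : 3 * θ ≤ θ₀ := by linarith [min_le_left (θ₀ / 3) (min (σ / 2) (1 / 8))]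
  have hθσ : 2 * θ ≤ σ := by
    linarith [min_le_right (θ₀ / 3) (min (σ / 2) (1 / 8)), min_le_left (σ / 2) (1 / 8 : ℝ)]
  have hθ8 : θ ≤ 1 / 8 := le_trans (min_le_right _ _) (min_le_right _ _)
  have hlay : ∫ z in Ioo (1 / 2 : ℝ) (1 / 2 + 3 * θ) ×ˢ Bset, ‖v z‖ ^ 2 ≤
      1 / (9 * Wmax + 1) * (3 * θ) ^ 2 := hlayer (3 * θ) ⟨by linarith, hθ3⟩
  -- ### the cut-off
  obtain ⟨η, hη2, hηc, hsupp, hη0, hη1, hplat, hPη, hgη⟩ := hηex B θ R' R'' hB8 hθ0 hθ8 hR'1 hR''2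
  set δ : ℝ := B / (8 * (R'' + 1) ^ 2) with hδ
  have hδ0 : 0 < δ := by rw [hδ]; exact div_pos (by linarith) (by positivity)
  set box : Set (ℝ × E) := Icc (1 / 2 + θ) (1 - δ) ×ˢ Bset with hbox
  have hsuppbox : tsupport η ⊆ box := hsupp
  have hboxK : IsCompact box := isCompact_Icc.prod hBsetcpt
  have hboxm : MeasurableSet box := measurableSet_Icc.prod hBsetm
  have hboxO : box ⊆ O := by
    intro z hz
    exact ⟨⟨by linarith [hz.1.1], by linarith [hz.1.2]⟩, hBsetH hz.2⟩
  have hbox1 : ∀ z ∈ box, 1 / 2 ≤ z.1 ∧ z.1 < 1 ∧ 3 / 2 ≤ ⟪z.2, e⟫ ∧ ⟪z.2, e⟫ ≤ R'' + 1 := by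
    intro z hz
    exact ⟨by linarith [hz.1.1], by linarith [hz.1.2], hz.2.1, hz.2.2.1⟩
  have hηs1 : tsupport η ⊆ Ioo (0 : ℝ) 1 ×ˢ {x : E | 1 < ⟪x, e⟫} := by
    intro z hz
    obtain ⟨h1, h2, h3, -⟩ := hbox1 z (hsuppbox hz)
    exact ⟨⟨by linarith, h2⟩, by show 1 < ⟪z.2, e⟫; linarith⟩
  have hηsO : tsupport η ⊆ O := hsuppbox.trans hboxO
  -- ### the set `G` and the second Carleman inequality
  set G : Set (ℝ × E) := {z : ℝ × E | 1 / 2 + σ ≤ z.1 ∧ z.1 ≤ 1 ∧ 1 ≤ ⟪z.2, e⟫ ∧ ⟪z.2, e⟫ ≤ R₁ ∧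
    ‖z.2‖ ^ 2 - ⟪z.2, e⟫ ^ 2 ≤ R₁ ^ 2 ∧ 4 * (Y₀ + 1) ^ 2 + 8 ≤ kA (3 / 4) z.1 * rhoA (3 / 4) ⟪z.2, e⟫}
    with hG
  have m1 : Measurable fun z : ℝ × E => z.1 := measurable_fst
  have m2 : Measurable fun z : ℝ × E => ⟪z.2, e⟫ := measurable_snd.inner measurable_const
  have m3 : Measurable fun z : ℝ × E => ‖z.2‖ ^ 2 - ⟪z.2, e⟫ ^ 2 :=
    (measurable_snd.norm.pow_const 2).sub (m2.pow_const 2)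
  have hkρm : Measurable fun z : ℝ × E => kA (3 / 4) z.1 * rhoA (3 / 4) ⟪z.2, e⟫ := by
    have h1 : Measurable (kA (3 / 4)) := by
      unfold kA; exact (measurable_id.pow_const _).sub (measurable_id.pow_const _)
    have h2 : Measurable (rhoA (3 / 4)) := by unfold rhoA; exact measurable_id.pow_const _
    exact (h1.comp m1).mul (h2.comp m2)
  have hGm : MeasurableSet G := by
    simp only [hG, Set.setOf_and]
    exact (measurableSet_le measurable_const m1).inter ((measurableSet_le m1 measurable_const).inter
      ((measurableSet_le measurable_const m2).inter ((measurableSet_le m2 measurable_const).inter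
      ((measurableSet_le m3 measurable_const).inter (measurableSet_le measurable_const hkρm)))))
  have hG1 : ∀ z ∈ G, η z = 1 := by
    intro z hz
    simp only [hG, mem_setOf_eq] at hz
    obtain ⟨hz1, -, hz3, hz4, hz5, hz6⟩ := hz
    refine hplat z (by linarith) hz3 (hz4.trans hR''R₁) (by rw [hBdef]; linarith) ?_
    exact hz5.trans (pow_le_pow_left₀ (by linarith) hR'R₁ 2)
  have hCarl := carleman_second_smul_le he hOo hv hBH hc ha hη2 hηc hηs1 hηsO hη0 hGm hG1
  -- ### the integrands
  set W : ℝ × E → ℝ := fun z => z.1 ^ 2 * Real.exp (2 * phiKR a (kA (3 / 4)) (rhoA (3 / 4)) e z)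
    with hW
  have hW0 : ∀ z, 0 ≤ W z := fun z => mul_nonneg (sq_nonneg _) (Real.exp_pos _).le
  set q : ℝ × E → ℝ := fun z => (1 + ⟪z.2, e⟫ ^ 2) ^ 2 with hq
  have hq0 : ∀ z, 0 ≤ q z := fun z => by positivity
  set f : ℝ × E → ℝ := fun z => W z * (q z * (‖v z‖ ^ 2 + gradSq v z)) with hf
  set g : ℝ × E → ℝ := fun z => W z * ‖v z‖ ^ 2 with hg
  have hf0 : ∀ z, 0 ≤ f z := fun z =>
    mul_nonneg (hW0 z) (mul_nonneg (hq0 z) (add_nonneg (sq_nonneg _) (gradSq_nonneg v z)))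
  have hg0 : ∀ z, 0 ≤ g z := fun z => mul_nonneg (hW0 z) (sq_nonneg _)
  have hgf : ∀ z, g z ≤ f z := by
    intro z
    have h1 : ‖v z‖ ^ 2 ≤ q z * (‖v z‖ ^ 2 + gradSq v z) := by
      have hq1 : 1 ≤ q z := by rw [hq]; nlinarith [sq_nonneg ⟪z.2, e⟫]
      nlinarith [gradSq_nonneg v z, sq_nonneg ‖v z‖, hq0 z]
    exact mul_le_mul_of_nonneg_left h1 (hW0 z)
  -- indicator values
  set M : Set (ℝ × E) := {z : ℝ × E | 0 < z.1 ∧ 0 < ⟪z.2, e⟫ ∧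
    kA (3 / 4) z.1 * rhoA (3 / 4) ⟪z.2, e⟫ ∈ Icc (B / 4) (B / 2)} with hM
  set iM : ℝ × E → ℝ := fun z => M.indicator (fun _ => (1 : ℝ)) z with hiM
  set iN : ℝ × E → ℝ := fun z => (Icc R'' (R'' + 1)).indicator (fun _ => (1 : ℝ)) ⟪z.2, e⟫ with hiN
  set iSh : ℝ × E → ℝ := fun z => (Icc (R' ^ 2) ((R' + 1) ^ 2)).indicator (fun _ => (1 : ℝ))
    (‖z.2‖ ^ 2 - ⟪z.2, e⟫ ^ 2) with hiSh
  set iL : ℝ × E → ℝ := fun z => (Icc (1 / 2 + θ) (1 / 2 + 2 * θ)).indicator (fun _ => (1 : ℝ)) z.1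
    with hiL
  have hiM01 : ∀ z, 0 ≤ iM z ∧ iM z ≤ 1 := fun z => by
    by_cases hx : z ∈ M
    · rw [hiM]; dsimp only; rw [Set.indicator_of_mem hx]; norm_num
    · rw [hiM]; dsimp only; rw [Set.indicator_of_notMem hx]; norm_num
  have hiN01 : ∀ z, 0 ≤ iN z ∧ iN z ≤ 1 := fun z => hind01 _ _
  have hiSh01 : ∀ z, 0 ≤ iSh z ∧ iSh z ≤ 1 := fun z => hind01 _ _
  have hiL01 : ∀ z, 0 ≤ iL z ∧ iL z ≤ 1 := fun z => hind01 _ _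
  have hMm : MeasurableSet M := by
    simp only [hM, Set.setOf_and]
    exact (measurableSet_lt measurable_const m1).inter ((measurableSet_lt measurable_const m2).inter
      (measurableSet_Icc.preimage hkρm |> fun h => h))
  have hiMm : Measurable iM := (measurable_const.indicator hMm)
  have hiNm : Measurable iN := (measurable_const.indicator measurableSet_Icc).comp m2
  have hiShm : Measurable iSh := (measurable_const.indicator measurableSet_Icc).comp m3
  have hiLm : Measurable iL := (measurable_const.indicator measurableSet_Icc).comp m1
  -- ### continuity and integrability on the box
  have hboxh : box ⊆ halfDom e := fun z hz => ⟨by linarith [hz.1.1], by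
    show 0 < ⟪z.2, e⟫
    linarith [hz.2.1]⟩
  have cφ : ContinuousOn (phiKR a (kA (3 / 4)) (rhoA (3 / 4)) e) box :=
    (contDiffOn_phiKR (contDiffOn_kA _) (contDiffOn_rhoA _) a e).continuousOn.mono hboxh
  have cW : ContinuousOn W box := (continuous_fst.pow 2).continuousOn.mul (continuousOn_const.mul cφ).rexp
  have cvO : ContinuousOn v O := hv.continuousOn
  have cgvO : ContinuousOn (gradSq v) O := by
    have hfd : ContinuousOn (fderiv ℝ v) O := hv.continuousOn_fderiv_of_isOpen hOo (by norm_num)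
    show ContinuousOn (fun z => gradSq v z) O
    simp only [gradSq, dx]
    exact continuousOn_finsetSum _ fun i _ => ((hfd.clm_apply continuousOn_const).norm.pow 2)
  have cq : Continuous q := ((continuous_const.add ((continuous_snd.inner continuous_const).pow 2)).pow 2)
  have cf : ContinuousOn f box :=
    cW.mul (cq.continuousOn.mul (((cvO.mono hboxO).norm.pow 2).add (cgvO.mono hboxO)))
  have cg : ContinuousOn g box := cW.mul ((cvO.mono hboxO).norm.pow 2)
  have if_ : IntegrableOn f box := cf.integrableOn_compact hboxK
  have ig_ : IntegrableOn g box := cg.integrableOn_compact hboxK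
  have ibdd : ∀ {i : ℝ × E → ℝ}, Measurable i → (∀ z, 0 ≤ i z ∧ i z ≤ 1) → ∀ {h : ℝ × E → ℝ},
      IntegrableOn h box → IntegrableOn (fun z => i z * h z) box := by
    intro i hi hi01 h hh
    refine Integrable.bdd_mul hh hi.aestronglyMeasurable (c := 1) (ae_of_all _ fun z => ?_)
    rw [Real.norm_eq_abs, abs_of_nonneg (hi01 z).1]; exact (hi01 z).2
  have iMf := ibdd hiMm hiM01 if_
  have iNf := ibdd hiNm hiN01 if_
  have iShf := ibdd hiShm hiSh01 if_
  have iLg := ibdd hiLm hiL01 ig_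
  -- η-quantities vanish off the support and are continuous
  have hηd0 : ∀ z ∉ tsupport η, fderiv ℝ η z = 0 := fun z hz =>
    fderiv_of_notMem_tsupport (𝕜 := ℝ) hz
  have hgη0 : ∀ z ∉ tsupport η, gradSq η z = 0 := fun z hz => by simp [gradSq, dx, hηd0 z hz]
  have hlapη0 : ∀ z ∉ tsupport η, lap η z = 0 := fun z hz =>
    image_eq_zero_of_notMem_tsupport fun h => hz (tsupport_lap_subset η h)
  have hdtη0 : ∀ z ∉ tsupport η, dt η z = 0 := fun z hz => by simp [dt, hηd0 z hz]
  have cfdr : ∀ u : ℝ × E, Continuous fun z => fderiv ℝ η z u :=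
    fun u => (hη2.continuous_fderiv (by norm_num)).clm_apply continuous_const
  have cfd2r : ∀ u u' : ℝ × E, Continuous fun z => fderiv ℝ (fun y => fderiv ℝ η y u) z u' := by
    intro u u'
    have h1 : ContDiff ℝ 1 fun y => fderiv ℝ η y u :=
      (hη2.fderiv_right (m := 1) le_rfl).clm_apply contDiff_const
    exact (h1.continuous_fderiv one_ne_zero).clm_apply continuous_const
  have cPη : Continuous fun z => dt η z + lap η z := by
    simp only [dt, lap, dx]
    exact (cfdr _).add (continuous_finsetSum _ fun i _ => cfd2r _ _)
  have cgη : Continuous (gradSq η) := by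
    show Continuous fun z => gradSq η z
    simp only [gradSq, dx]
    exact continuous_finsetSum _ fun i _ => ((cfdr _).norm.pow 2)
  -- ### from the `J`'s to the box integrals
  set TM : ℝ := ∫ z in box, iM z * f z with hTM
  set TN : ℝ := ∫ z in box, iN z * f z with hTN
  set TSh : ℝ := ∫ z in box, iSh z * f z with hTSh
  set TL : ℝ := ∫ z in box, iL z * g z with hTL
  have hI0 : ∀ z, 0 ≤ iM z + iN z + iSh z := fun z => by
    linarith [(hiM01 z).1, (hiN01 z).1, (hiSh01 z).1]
  have iIf : IntegrableOn (fun z => (iM z + iN z + iSh z) * f z) box := by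
    have := (iMf.add iNf).add iShf
    refine this.congr (ae_of_all _ fun z => ?_)
    simp only [Pi.add_apply]; ring
  have hIT : ∫ z in box, (iM z + iN z + iSh z) * f z = TM + TN + TSh := by
    have e1 : (fun z => (iM z + iN z + iSh z) * f z) = fun z => (iM z * f z + iN z * f z) + iSh z * f z := by
      funext z; ring
    have i12 : IntegrableOn (fun z => iM z * f z + iN z * f z) box := iMf.add iNf
    rw [e1, integral_add i12 iShf, integral_add iMf iNf]
  -- `J1 ≤ Cη (TM + TN + TSh)`
  have hJ1 : ∫ z, W z * (gradSq η z * ‖v z‖ ^ 2) ≤ Cη * (TM + TN + TSh) := by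
    have e1 : ∫ z, W z * (gradSq η z * ‖v z‖ ^ 2) = ∫ z in box, W z * (gradSq η z * ‖v z‖ ^ 2) :=
      (setIntegral_eq_integral_of_forall_compl_eq_zero fun z hz => by
        rw [hgη0 z fun h => hz (hsuppbox h)]; simp).symm
    rw [e1, ← hIT, ← integral_const_mul]
    refine setIntegral_mono_on ?_ (iIf.const_mul _) hboxm fun z hz => ?_
    · exact (cW.mul (cgη.continuousOn.mul ((cvO.mono hboxO).norm.pow 2))).integrableOn_compact hboxK
    · have h1 := hgη z
      have h2 : gradSq η z * ‖v z‖ ^ 2 ≤ Cη * (q z * (iM z + iN z + iSh z)) * (‖v z‖ ^ 2 + gradSq v z) :=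
        mul_le_mul h1 (by linarith [gradSq_nonneg v z]) (sq_nonneg _)
          (mul_nonneg hCη.le (mul_nonneg (hq0 z) (hI0 z)))
      calc W z * (gradSq η z * ‖v z‖ ^ 2)
          ≤ W z * (Cη * (q z * (iM z + iN z + iSh z)) * (‖v z‖ ^ 2 + gradSq v z)) :=
            mul_le_mul_of_nonneg_left h2 (hW0 z)
        _ = Cη * ((iM z + iN z + iSh z) * f z) := by simp only [hf]; ring
  -- `J2 ≤ Cη (θ⁻² TL + TM + TN + TSh)`
  have hJ2 : ∫ z, W z * ((dt η z + lap η z) ^ 2 * ‖v z‖ ^ 2) ≤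
      Cη * (θ⁻¹ ^ 2 * TL + (TM + TN + TSh)) := by
    have e1 : ∫ z, W z * ((dt η z + lap η z) ^ 2 * ‖v z‖ ^ 2) =
        ∫ z in box, W z * ((dt η z + lap η z) ^ 2 * ‖v z‖ ^ 2) :=
      (setIntegral_eq_integral_of_forall_compl_eq_zero fun z hz => by
        rw [hdtη0 z fun h => hz (hsuppbox h), hlapη0 z fun h => hz (hsuppbox h)]; simp).symm
    have e2 : Cη * (θ⁻¹ ^ 2 * TL + (TM + TN + TSh)) =
        ∫ z in box, Cη * (θ⁻¹ ^ 2 * (iL z * g z) + (iM z + iN z + iSh z) * f z) := by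
      rw [integral_const_mul, integral_add (iLg.const_mul _) iIf, integral_const_mul, hIT]
    rw [e1, e2]
    refine setIntegral_mono_on ?_ (((iLg.const_mul _).add iIf).const_mul _) hboxm fun z hz => ?_
    · exact (cW.mul ((cPη.pow 2).continuousOn.mul ((cvO.mono hboxO).norm.pow 2))).integrableOn_compact
        hboxK
    · have h1 := hPη z
      have hvv : ‖v z‖ ^ 2 ≤ ‖v z‖ ^ 2 + gradSq v z := by linarith [gradSq_nonneg v z]
      have hA : 0 ≤ θ⁻¹ ^ 2 * iL z := mul_nonneg (by positivity) (hiL01 z).1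
      calc W z * ((dt η z + lap η z) ^ 2 * ‖v z‖ ^ 2)
          ≤ W z * (Cη * (θ⁻¹ ^ 2 * iL z + q z * (iM z + iN z + iSh z)) * ‖v z‖ ^ 2) :=
            mul_le_mul_of_nonneg_left (mul_le_mul_of_nonneg_right h1 (sq_nonneg _)) (hW0 z)
        _ = Cη * (θ⁻¹ ^ 2 * (iL z * g z) + (iM z + iN z + iSh z) * (W z * (q z * ‖v z‖ ^ 2))) := by
            simp only [hg]; ring
        _ ≤ Cη * (θ⁻¹ ^ 2 * (iL z * g z) + (iM z + iN z + iSh z) * f z) := by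
            refine mul_le_mul_of_nonneg_left (add_le_add le_rfl ?_) hCη.le
            refine mul_le_mul_of_nonneg_left ?_ (hI0 z)
            exact mul_le_mul_of_nonneg_left (mul_le_mul_of_nonneg_left hvv (hq0 z)) (hW0 z)
  -- `J3 ≤ Cη (TM + TN + TSh)`
  have hJ3 : ∫ z, W z * (gradSq η z * gradSq v z) ≤ Cη * (TM + TN + TSh) := by
    have e1 : ∫ z, W z * (gradSq η z * gradSq v z) = ∫ z in box, W z * (gradSq η z * gradSq v z) :=
      (setIntegral_eq_integral_of_forall_compl_eq_zero fun z hz => by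
        rw [hgη0 z fun h => hz (hsuppbox h)]; simp).symm
    rw [e1, ← hIT, ← integral_const_mul]
    refine setIntegral_mono_on ?_ (iIf.const_mul _) hboxm fun z hz => ?_
    · exact (cW.mul (cgη.continuousOn.mul (cgvO.mono hboxO))).integrableOn_compact hboxK
    · have h1 := hgη z
      have h2 : gradSq η z * gradSq v z ≤ Cη * (q z * (iM z + iN z + iSh z)) * (‖v z‖ ^ 2 + gradSq v z) :=
        mul_le_mul h1 (by linarith [sq_nonneg ‖v z‖]) (gradSq_nonneg v z)
          (mul_nonneg hCη.le (mul_nonneg (hq0 z) (hI0 z)))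
      calc W z * (gradSq η z * gradSq v z)
          ≤ W z * (Cη * (q z * (iM z + iN z + iSh z)) * (‖v z‖ ^ 2 + gradSq v z)) :=
            mul_le_mul_of_nonneg_left h2 (hW0 z)
        _ = Cη * ((iM z + iN z + iSh z) * f z) := by simp only [hf]; ring
  -- ### the four box integrals
  -- common facts on the box
  have hboxfacts : ∀ z ∈ box, z ∈ O ∧ 1 / 2 ≤ z.1 ∧ z.1 ≤ 1 ∧ z.1 < 1 ∧ 1 ≤ ⟪z.2, e⟫ ∧
      ⟪z.2, e⟫ ≤ R'' + 1 ∧ z.1 ∈ Icc (1 / 2 : ℝ) 1 := by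
    intro z hz
    obtain ⟨h1, h2, h3, h4⟩ := hbox1 z hz
    exact ⟨hboxO hz, h1, h2.le, h2, by linarith, h4, ⟨h1, h2.le⟩⟩
  have hΦβbox : ∀ z ∈ box, Φβ z = Real.exp (-(β' / 2 * ‖z.2‖ ^ 2)) := by
    intro z hz
    rw [hΦβ]; dsimp only
    rw [Set.indicator_of_mem (hboxfacts z hz).2.2.2.2.2.2, one_mul]
  have hΦ₈box : ∀ z ∈ box, Φ₈ z = Real.exp (-(1 / 8 * ‖z.2‖ ^ 2)) := by
    intro z hz
    rw [hΦ₈]; dsimp only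
    rw [Set.indicator_of_mem (hboxfacts z hz).2.2.2.2.2.2, one_mul]
  have hfle : ∀ z ∈ box, f z ≤ Real.exp (2 * a * (kA (3 / 4) z.1 * rhoA (3 / 4) ⟪z.2, e⟫)) *
      (Real.exp (-(‖z.2‖ ^ 2 - ⟪z.2, e⟫ ^ 2) / 4) * (q z * (‖v z‖ ^ 2 + gradSq v z))) := by
    intro z hz
    obtain ⟨-, h1, h2, -⟩ := hboxfacts z hz
    have hw := weight2_le (a := a) he h1 h2
    have h3 : 0 ≤ q z * (‖v z‖ ^ 2 + gradSq v z) :=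
      mul_nonneg (hq0 z) (add_nonneg (sq_nonneg _) (gradSq_nonneg v z))
    calc f z = W z * (q z * (‖v z‖ ^ 2 + gradSq v z)) := rfl
      _ ≤ (Real.exp (-(‖z.2‖ ^ 2 - ⟪z.2, e⟫ ^ 2) / 4) *
          Real.exp (2 * a * (kA (3 / 4) z.1 * rhoA (3 / 4) ⟪z.2, e⟫))) *
          (q z * (‖v z‖ ^ 2 + gradSq v z)) := mul_le_mul_of_nonneg_right hw h3
      _ = _ := by ring
  -- `TM ≤ e^{aB} KM`
  have hTM : TM ≤ Real.exp (a * B) * KM := by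
    have hpt : ∀ z ∈ box, iM z * f z ≤ Real.exp (a * B) * (Cd ^ 2 * Cβ) * Φβ z := by
      intro z hz
      obtain ⟨hzO, h1, h2, h3, h4, h5, h6⟩ := hboxfacts z hz
      by_cases hzM : z ∈ M
      · have hi : iM z = 1 := by rw [hiM]; dsimp only; rw [Set.indicator_of_mem hzM]
        rw [hi, one_mul, hΦβbox z hz]
        obtain ⟨-, -, hk1, hk2⟩ := hzM
        have hyn : Y₀ + 1 ≤ ⟪z.2, e⟫ :=
          yn_ge_of_krho_ge h1 h2 h4 (by linarith) (hBY.trans hk1)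
        have hd := hdec z hzO h3 (by linarith)
        have hmaj := majorant_of_decay (X := 1) he hβ' hβ'8
          (Real.one_le_exp (by positivity)) hd
        rw [one_mul, ← hCβ] at hmaj
        have hexp : Real.exp (2 * a * (kA (3 / 4) z.1 * rhoA (3 / 4) ⟪z.2, e⟫)) ≤ Real.exp (a * B) := by
          rw [Real.exp_le_exp]; nlinarith
        have hnn : 0 ≤ Real.exp (-(‖z.2‖ ^ 2 - ⟪z.2, e⟫ ^ 2) / 4) * (q z * (‖v z‖ ^ 2 + gradSq v z)) :=
          mul_nonneg (Real.exp_pos _).le (mul_nonneg (hq0 z) (add_nonneg (sq_nonneg _) (gradSq_nonneg v z)))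
        calc f z ≤ Real.exp (2 * a * (kA (3 / 4) z.1 * rhoA (3 / 4) ⟪z.2, e⟫)) *
              (Real.exp (-(‖z.2‖ ^ 2 - ⟪z.2, e⟫ ^ 2) / 4) * (q z * (‖v z‖ ^ 2 + gradSq v z))) :=
              hfle z hz
          _ ≤ Real.exp (a * B) * (Cd ^ 2 * Cβ * Real.exp (-(β' / 2 * ‖z.2‖ ^ 2))) :=
              mul_le_mul hexp hmaj hnn (Real.exp_pos _).le
          _ = Real.exp (a * B) * (Cd ^ 2 * Cβ) * Real.exp (-(β' / 2 * ‖z.2‖ ^ 2)) := by ring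
      · have hi : iM z = 0 := by rw [hiM]; dsimp only; rw [Set.indicator_of_notMem hzM]
        rw [hi, zero_mul]
        exact mul_nonneg (by positivity) (hΦβ0 z)
    calc TM ≤ ∫ z in box, Real.exp (a * B) * (Cd ^ 2 * Cβ) * Φβ z :=
          setIntegral_mono_on iMf (hΦβi.integrableOn.const_mul _) hboxm hpt
      _ = Real.exp (a * B) * (Cd ^ 2 * Cβ) * ∫ z in box, Φβ z := integral_const_mul _ _
      _ ≤ Real.exp (a * B) * (Cd ^ 2 * Cβ) * ∫ z, Φβ z := by
          refine mul_le_mul_of_nonneg_left ?_ (by positivity)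
          exact setIntegral_le_integral hΦβi (Eventually.of_forall hΦβ0)
      _ = Real.exp (a * B) * KM := by rw [hKM]; ring
  -- `TN ≤ 1`
  have hTN : TN ≤ 1 := by
    have hpt : ∀ z ∈ box, iN z * f z ≤
        (Cd ^ 2 * Cβ) * ({z : ℝ × E | R'' ≤ ⟪z.2, e⟫}.indicator Φβ z) := by
      intro z hz
      obtain ⟨hzO, h1, h2, h3, h4, h5, h6⟩ := hboxfacts z hz
      by_cases hzN : ⟪z.2, e⟫ ∈ Icc R'' (R'' + 1)
      · have hi : iN z = 1 := by rw [hiN]; dsimp only; rw [Set.indicator_of_mem hzN]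
        have hmem : z ∈ {z : ℝ × E | R'' ≤ ⟪z.2, e⟫} := hzN.1
        rw [hi, one_mul, Set.indicator_of_mem hmem, hΦβbox z hz]
        have hd := hdec z hzO h3 (by linarith [hzN.1, hR''Y])
        have hX := exp_krho_le_of_large h1 h2 h4 ha0 hβ' (hR''a.trans hzN.1)
        have hmaj := majorant_of_decay he hβ' hβ'8 hX hd
        rw [← hCβ] at hmaj
        exact (hfle z hz).trans hmaj
      · have hi : iN z = 0 := by rw [hiN]; dsimp only; rw [Set.indicator_of_notMem hzN]
        rw [hi, zero_mul]
        exact mul_nonneg (by positivity) (Set.indicator_nonneg (fun _ _ => hΦβ0 _) _)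
    have hmsN : MeasurableSet {z : ℝ × E | R'' ≤ ⟪z.2, e⟫} := measurableSet_le measurable_const m2
    calc TN ≤ ∫ z in box, (Cd ^ 2 * Cβ) * ({z : ℝ × E | R'' ≤ ⟪z.2, e⟫}.indicator Φβ z) :=
          setIntegral_mono_on iNf ((hΦβi.indicator hmsN).integrableOn.const_mul _) hboxm hpt
      _ = (Cd ^ 2 * Cβ) * ∫ z in box, {z : ℝ × E | R'' ≤ ⟪z.2, e⟫}.indicator Φβ z :=
          integral_const_mul _ _
      _ ≤ (Cd ^ 2 * Cβ) * ∫ z, {z : ℝ × E | R'' ≤ ⟪z.2, e⟫}.indicator Φβ z := by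
          refine mul_le_mul_of_nonneg_left ?_ (by positivity)
          exact setIntegral_le_integral (hΦβi.indicator hmsN)
            (Eventually.of_forall fun z => Set.indicator_nonneg (fun _ _ => hΦβ0 _) _)
      _ = (Cd ^ 2 * Cβ) * ∫ z in {z : ℝ × E | R'' ≤ ⟪z.2, e⟫}, Φβ z := by
          rw [integral_indicator hmsN]
      _ ≤ 1 := hTN1
  -- `TSh ≤ 1`
  have hTSh : TSh ≤ 1 := by
    have hpt : ∀ z ∈ box, iSh z * f z ≤
        KSh * ({z : ℝ × E | R' ^ 2 ≤ ‖z.2‖ ^ 2 - ⟪z.2, e⟫ ^ 2}.indicator Φ₈ z) := by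
      intro z hz
      obtain ⟨hzO, h1, h2, h3, h4, h5, h6⟩ := hboxfacts z hz
      by_cases hzS : ‖z.2‖ ^ 2 - ⟪z.2, e⟫ ^ 2 ∈ Icc (R' ^ 2) ((R' + 1) ^ 2)
      · have hi : iSh z = 1 := by rw [hiSh]; dsimp only; rw [Set.indicator_of_mem hzS]
        have hmem : z ∈ {z : ℝ × E | R' ^ 2 ≤ ‖z.2‖ ^ 2 - ⟪z.2, e⟫ ^ 2} := hzS.1
        rw [hi, one_mul, Set.indicator_of_mem hmem, hΦ₈box z hz]
        have hgrz := hgr z hzO h3 (by linarith [(hbox1 z hz).2.2.1])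
        have hX : Real.exp (2 * a * (kA (3 / 4) z.1 * rhoA (3 / 4) ⟪z.2, e⟫)) ≤
            Real.exp (2 * a * (R'' + 1) ^ 2) := by
          rw [Real.exp_le_exp]
          have hk := krho_le_sq h1 h2 h4
          have hr2 : ⟪z.2, e⟫ ^ 2 ≤ (R'' + 1) ^ 2 := pow_le_pow_left₀ (by linarith) h5 2
          exact mul_le_mul_of_nonneg_left (hk.trans hr2) (by linarith)
        have hmaj := majorant_of_growth (v := v) hX (by linarith : (0 : ℝ) ≤ ⟪z.2, e⟫) h5 hgrz
        refine (hfle z hz).trans (hmaj.trans (le_of_eq ?_))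
        rw [hKSh]
        congr 1
        ring_nf
      · have hi : iSh z = 0 := by rw [hiSh]; dsimp only; rw [Set.indicator_of_notMem hzS]
        rw [hi, zero_mul]
        exact mul_nonneg hKSh0 (Set.indicator_nonneg (fun _ _ => hΦ₈0 _) _)
    have hmsS : MeasurableSet {z : ℝ × E | R' ^ 2 ≤ ‖z.2‖ ^ 2 - ⟪z.2, e⟫ ^ 2} :=
      measurableSet_le measurable_const m3
    calc TSh ≤ ∫ z in box, KSh * ({z : ℝ × E | R' ^ 2 ≤ ‖z.2‖ ^ 2 - ⟪z.2, e⟫ ^ 2}.indicator Φ₈ z) :=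
          setIntegral_mono_on iShf ((hΦ₈i.indicator hmsS).integrableOn.const_mul _) hboxm hpt
      _ = KSh * ∫ z in box, {z : ℝ × E | R' ^ 2 ≤ ‖z.2‖ ^ 2 - ⟪z.2, e⟫ ^ 2}.indicator Φ₈ z :=
          integral_const_mul _ _
      _ ≤ KSh * ∫ z, {z : ℝ × E | R' ^ 2 ≤ ‖z.2‖ ^ 2 - ⟪z.2, e⟫ ^ 2}.indicator Φ₈ z := by
          refine mul_le_mul_of_nonneg_left ?_ hKSh0
          exact setIntegral_le_integral (hΦ₈i.indicator hmsS)
            (Eventually.of_forall fun z => Set.indicator_nonneg (fun _ _ => hΦ₈0 _) _)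
      _ = KSh * ∫ z in {z : ℝ × E | R' ^ 2 ≤ ‖z.2‖ ^ 2 - ⟪z.2, e⟫ ^ 2}, Φ₈ z := by
          rw [integral_indicator hmsS]
      _ ≤ 1 := hTSh1
  -- `θ⁻² TL ≤ 1`
  have hTL : θ⁻¹ ^ 2 * TL ≤ 1 := by
    set Lay : Set (ℝ × E) := Ioo (1 / 2 : ℝ) (1 / 2 + 3 * θ) ×ˢ Bset with hLay
    have hLaym : MeasurableSet Lay := measurableSet_Ioo.prod hBsetm
    have hLayK : Lay ⊆ Icc (1 / 2 : ℝ) 1 ×ˢ Bset :=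
      Set.prod_mono (fun s hs => ⟨hs.1.le, by linarith [hs.2, hθ8]⟩) Subset.rfl
    have hvLay : IntegrableOn (fun z => ‖v z‖ ^ 2) Lay :=
      (((hcont.mono (Set.prod_mono Subset.rfl hBsetH)).norm.pow 2).integrableOn_compact
        (isCompact_Icc.prod hBsetcpt)).mono_set hLayK
    have hpt : ∀ z ∈ box, iL z * g z ≤ Wmax * (Lay.indicator (fun z => ‖v z‖ ^ 2) z) := by
      intro z hz
      obtain ⟨hzO, h1, h2, h3, h4, h5, h6⟩ := hboxfacts z hz
      by_cases hzL : z.1 ∈ Icc (1 / 2 + θ) (1 / 2 + 2 * θ)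
      · have hi : iL z = 1 := by rw [hiL]; dsimp only; rw [Set.indicator_of_mem hzL]
        have hmem : z ∈ Lay := ⟨⟨by linarith [hzL.1], by linarith [hzL.2]⟩, hz.2⟩
        rw [hi, one_mul, Set.indicator_of_mem hmem]
        exact mul_le_mul_of_nonneg_right (hWle z h1 h2 h4 h5) (sq_nonneg _)
      · have hi : iL z = 0 := by rw [hiL]; dsimp only; rw [Set.indicator_of_notMem hzL]
        rw [hi, zero_mul]
        exact mul_nonneg hWmax0.le (Set.indicator_nonneg (fun _ _ => sq_nonneg _) _)
    have h1 : TL ≤ Wmax * ∫ z in Lay, ‖v z‖ ^ 2 := by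
      calc TL ≤ ∫ z in box, Wmax * (Lay.indicator (fun z => ‖v z‖ ^ 2) z) :=
            setIntegral_mono_on iLg (((hvLay.integrable_indicator hLaym).integrableOn).const_mul _)
              hboxm hpt
        _ = Wmax * ∫ z in box, Lay.indicator (fun z => ‖v z‖ ^ 2) z := integral_const_mul _ _
        _ ≤ Wmax * ∫ z, Lay.indicator (fun z => ‖v z‖ ^ 2) z := by
            refine mul_le_mul_of_nonneg_left ?_ hWmax0.le
            exact setIntegral_le_integral (hvLay.integrable_indicator hLaym)
              (Eventually.of_forall fun z => Set.indicator_nonneg (fun _ _ => sq_nonneg _) _)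
        _ = Wmax * ∫ z in Lay, ‖v z‖ ^ 2 := by rw [integral_indicator hLaym]
    have h2 : θ⁻¹ ^ 2 * (Wmax * (1 / (9 * Wmax + 1) * (3 * θ) ^ 2)) ≤ 1 := by
      have e : θ⁻¹ ^ 2 * (Wmax * (1 / (9 * Wmax + 1) * (3 * θ) ^ 2)) = 9 * Wmax / (9 * Wmax + 1) := by
        field_simp
        ring
      rw [e, div_le_one (by positivity)]
      linarith
    calc θ⁻¹ ^ 2 * TL ≤ θ⁻¹ ^ 2 * (Wmax * (1 / (9 * Wmax + 1) * (3 * θ) ^ 2)) := by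
          refine mul_le_mul_of_nonneg_left (h1.trans ?_) (by positivity)
          exact mul_le_mul_of_nonneg_left hlay hWmax0.le
      _ ≤ 1 := h2
  -- ### conclusion
  have hT0 : ∀ {i : ℝ × E → ℝ}, (∀ z, 0 ≤ i z ∧ i z ≤ 1) → ∀ {h : ℝ × E → ℝ}, (∀ z, 0 ≤ h z) →
      0 ≤ ∫ z in box, i z * h z := by
    intro i hi h hh
    exact setIntegral_nonneg hboxm fun z _ => mul_nonneg (hi z).1 (hh z)
  have hTM0 : 0 ≤ TM := hT0 hiM01 hf0
  have hTN0 : 0 ≤ TN := hT0 hiN01 hf0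
  have hTSh0 : 0 ≤ TSh := hT0 hiSh01 hf0
  have hTL0 : 0 ≤ TL := hT0 hiL01 hg0
  have hsum : (∫ z, W z * (gradSq η z * ‖v z‖ ^ 2)) +
      6 * 11 * (∫ z, W z * ((dt η z + lap η z) ^ 2 * ‖v z‖ ^ 2)) +
      24 * 11 * (∫ z, W z * (gradSq η z * gradSq v z)) ≤
      Cη * (331 * (TM + TN + TSh) + 66 * (θ⁻¹ ^ 2 * TL)) := by
    linarith only [hJ1, hJ2, hJ3]
  have hbd : 331 * (TM + TN + TSh) + 66 * (θ⁻¹ ^ 2 * TL) ≤ 331 * (Real.exp (a * B) * KM + 2) + 66 := by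
    linarith only [hTM, hTN, hTSh, hTL]
  have hfinal : ∫ z in G, W z * ‖v z‖ ^ 2 ≤ Cη * (331 * (Real.exp (a * B) * KM + 2) + 66) :=
    (hCarl.trans hsum).trans (mul_le_mul_of_nonneg_left hbd hCη.le)
  rw [hBdef, hKM, hCβ] at hfinal
  exact hfinal

/-! ### Vanishing above the level set -/

set_option maxHeartbeats 800000 in
/-- **Seregin 2014, Lemma A.3, the Carleman step**: under the hypotheses of `vanish_core`
(`v ∈ C²` on `]1/2, 3/2[ × {⟪y,e⟫ > 0}` with `|∂ₛv + Δv| ≤ c(|v| + |∇v|)`, `c² ≤ 1/264`,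
vanishing continuously on `s = 1/2`, `∂ₛv` locally square integrable, the growth bound (A.3.9)
for `yₙ > 1` and the decay (A.3.20) for `yₙ ≥ Y₀`), `v(s, y) = 0` whenever `1/2 < s < 1` and
`k(s)ρ(⟪y, e⟫) > B = 4(Y₀ + 1)² + 8` ("Passing to the limit as `a → +∞`, we see that
`v(y, s) = 0` if `1/2 ≤ s < 1` and `φ_B(yₙ, s) > 0`"). [cite: Seregin2014, App. A.3, proof of Lemma A.3] -/
theorem vanish_of_carleman_second {v : ℝ × E → F} {e : E} {c Cg Cd β' Y₀ : ℝ} (he : ‖e‖ = 1)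
    (hc : c ^ 2 ≤ 1 / (24 * 11)) (hβ' : 0 < β') (hβ'8 : β' ≤ 1 / 8) (hY₀ : 1 ≤ Y₀)
    (hv : ContDiffOn ℝ 2 v (Ioo (1 / 2 : ℝ) (3 / 2) ×ˢ {y : E | 0 < ⟪y, e⟫}))
    (hBH : ∀ z ∈ Ioo (1 / 2 : ℝ) (3 / 2) ×ˢ {y : E | 0 < ⟪y, e⟫},
      ‖dt v z + lap v z‖ ≤ c * (‖v z‖ + Real.sqrt (gradSq v z)))
    (hcont : ContinuousOn v (Icc (1 / 2 : ℝ) 1 ×ˢ {y : E | 0 < ⟪y, e⟫}))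
    (h0 : ∀ y : E, 0 < ⟪y, e⟫ → v (1 / 2, y) = 0)
    (hH3 : ∀ K ⊆ Ioo (1 / 2 : ℝ) (3 / 2) ×ˢ {y : E | 0 < ⟪y, e⟫}, Bornology.IsBounded K →
      MeasurableSet K → ∫⁻ z in K, ‖dt v z‖ₑ ^ 2 < ∞)
    (hgr : ∀ z ∈ Ioo (1 / 2 : ℝ) (3 / 2) ×ˢ {y : E | 0 < ⟪y, e⟫}, z.1 < 1 → 1 < ⟪z.2, e⟫ →
      ‖v z‖ + Real.sqrt (gradSq v z) ≤ Cg * Real.exp (‖z.2‖ ^ 2 / 48))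
    (hdec : ∀ z ∈ Ioo (1 / 2 : ℝ) (3 / 2) ×ˢ {y : E | 0 < ⟪y, e⟫}, z.1 < 1 → Y₀ ≤ ⟪z.2, e⟫ →
      ‖v z‖ + Real.sqrt (gradSq v z) ≤
        Cd * Real.exp ((‖z.2‖ ^ 2 - ⟪z.2, e⟫ ^ 2) / 48) * Real.exp (-(β' * ⟪z.2, e⟫ ^ 2))) :
    ∀ z ∈ Ioo (1 / 2 : ℝ) (3 / 2) ×ˢ {y : E | 0 < ⟪y, e⟫}, z.1 < 1 →
      4 * (Y₀ + 1) ^ 2 + 8 < kA (3 / 4) z.1 * rhoA (3 / 4) ⟪z.2, e⟫ → v z = 0 := by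
  obtain ⟨Cη, hCη, hηex0⟩ := exists_cutoff_second' (E := E)
  have hηex := hηex0 e he
  obtain ⟨B, hBdef⟩ : ∃ B : ℝ, B = 4 * (Y₀ + 1) ^ 2 + 8 := ⟨_, rfl⟩
  have hB0 : 0 < B := by rw [hBdef]; positivity
  have hBY : (Y₀ + 1) ^ 2 ≤ B := by rw [hBdef]; nlinarith
  set H : Set E := {y : E | 0 < ⟪y, e⟫} with hH
  set O : Set (ℝ × E) := Ioo (1 / 2 : ℝ) (3 / 2) ×ˢ H with hO
  have hHo : IsOpen H := isOpen_lt continuous_const (continuous_id.inner continuous_const)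
  have hOo : IsOpen O := isOpen_Ioo.prod hHo
  set KM : ℝ := Cd ^ 2 * (2 + 2 * (2 / (Real.exp 1 * (β' / 2))) ^ (2 : ℝ)) *
    ∫ z : ℝ × E, (Icc (1 / 2 : ℝ) 1).indicator (fun _ => (1 : ℝ)) z.1 *
      Real.exp (-(β' / 2 * ‖z.2‖ ^ 2)) with hKM
  have hKM0 : 0 ≤ KM := by
    rw [hKM]
    refine mul_nonneg (by positivity) (integral_nonneg fun z => ?_)
    exact mul_nonneg (Set.indicator_nonneg (fun _ _ => zero_le_one) _) (Real.exp_pos _).le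
  -- ### Step 1: `∫_G |v|² = 0` on the sets `G(σ, R₁)`
  have hzero : ∀ σ R₁ : ℝ, 0 < σ → σ ≤ 1 / 4 → 1 ≤ R₁ →
      IntegrableOn (fun z => ‖v z‖ ^ 2) {z : ℝ × E | 1 / 2 + σ ≤ z.1 ∧ z.1 ≤ 1 ∧ 1 ≤ ⟪z.2, e⟫ ∧
        ⟪z.2, e⟫ ≤ R₁ ∧ ‖z.2‖ ^ 2 - ⟪z.2, e⟫ ^ 2 ≤ R₁ ^ 2 ∧
        4 * (Y₀ + 1) ^ 2 + 8 ≤ kA (3 / 4) z.1 * rhoA (3 / 4) ⟪z.2, e⟫} ∧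
      ∫ z in {z : ℝ × E | 1 / 2 + σ ≤ z.1 ∧ z.1 ≤ 1 ∧ 1 ≤ ⟪z.2, e⟫ ∧ ⟪z.2, e⟫ ≤ R₁ ∧
        ‖z.2‖ ^ 2 - ⟪z.2, e⟫ ^ 2 ≤ R₁ ^ 2 ∧ 4 * (Y₀ + 1) ^ 2 + 8 ≤ kA (3 / 4) z.1 * rhoA (3 / 4) ⟪z.2, e⟫},
        ‖v z‖ ^ 2 = 0 := by
    intro σ R₁ hσ hσ1 hR₁
    set G : Set (ℝ × E) := {z : ℝ × E | 1 / 2 + σ ≤ z.1 ∧ z.1 ≤ 1 ∧ 1 ≤ ⟪z.2, e⟫ ∧ ⟪z.2, e⟫ ≤ R₁ ∧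
        ‖z.2‖ ^ 2 - ⟪z.2, e⟫ ^ 2 ≤ R₁ ^ 2 ∧ 4 * (Y₀ + 1) ^ 2 + 8 ≤ kA (3 / 4) z.1 * rhoA (3 / 4) ⟪z.2, e⟫}
      with hG
    -- `G` lies in a compact subset of the region of continuity
    set KG : Set (ℝ × E) := Icc (1 / 2 + σ) 1 ×ˢ ({y : E | 1 ≤ ⟪y, e⟫} ∩ closedBall (0 : E) (R₁ + R₁)) with hKG
    have hce : Continuous fun y : E => ⟪y, e⟫ := continuous_id.inner continuous_const
    have hKGc : IsCompact KG := isCompact_Icc.prod ((isCompact_closedBall _ _).inter_left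
      (isClosed_le continuous_const hce))
    have hGKG : G ⊆ KG := by
      intro z hz
      obtain ⟨h1, h2, h3, h4, h5, -⟩ := hz
      refine ⟨⟨h1, h2⟩, h3, ?_⟩
      rw [mem_closedBall, dist_zero_right]
      have : ‖z.2‖ ^ 2 ≤ (R₁ + R₁) ^ 2 := by nlinarith
      nlinarith [norm_nonneg z.2]
    have hKGc' : KG ⊆ Icc (1 / 2 : ℝ) 1 ×ˢ H := by
      intro z hz
      have h1 : 1 ≤ ⟪z.2, e⟫ := hz.2.1
      exact ⟨⟨by linarith [hz.1.1], hz.1.2⟩, by show 0 < ⟪z.2, e⟫; linarith⟩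
    have hvG : IntegrableOn (fun z => ‖v z‖ ^ 2) G :=
      (((hcont.mono hKGc').norm.pow 2).integrableOn_compact hKGc).mono_set hGKG
    refine ⟨hvG, ?_⟩
    have hI0 : 0 ≤ ∫ z in G, ‖v z‖ ^ 2 := integral_nonneg fun z => sq_nonneg _
    -- measurability of `G`
    have m1 : Measurable fun z : ℝ × E => z.1 := measurable_fst
    have m2 : Measurable fun z : ℝ × E => ⟪z.2, e⟫ := measurable_snd.inner measurable_const
    have m3 : Measurable fun z : ℝ × E => ‖z.2‖ ^ 2 - ⟪z.2, e⟫ ^ 2 :=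
      (measurable_snd.norm.pow_const 2).sub (m2.pow_const 2)
    have hkρm : Measurable fun z : ℝ × E => kA (3 / 4) z.1 * rhoA (3 / 4) ⟪z.2, e⟫ := by
      have h1 : Measurable (kA (3 / 4)) := by
        unfold kA; exact (measurable_id.pow_const _).sub (measurable_id.pow_const _)
      have h2 : Measurable (rhoA (3 / 4)) := by unfold rhoA; exact measurable_id.pow_const _
      exact (h1.comp m1).mul (h2.comp m2)
    have hGm : MeasurableSet G := by
      simp only [hG, Set.setOf_and]
      exact (measurableSet_le measurable_const m1).inter ((measurableSet_le m1 measurable_const).inter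
        ((measurableSet_le measurable_const m2).inter ((measurableSet_le m2 measurable_const).inter
        ((measurableSet_le m3 measurable_const).inter (measurableSet_le measurable_const hkρm)))))
    -- the weight is continuous on `KG`
    have hKGh : KG ⊆ halfDom e := fun z hz => ⟨by linarith [hz.1.1], by
      have h1 : 1 ≤ ⟪z.2, e⟫ := hz.2.1
      show 0 < ⟪z.2, e⟫
      linarith⟩
    -- ### the bound for every `a ≥ 2`
    have hbound : ∀ a : ℝ, 2 ≤ a → ∫ z in G, ‖v z‖ ^ 2 ≤
        4 * Real.exp (R₁ ^ 2 / 2) * (Cη * (331 * KM * Real.exp (-(a * B)) +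
          728 * Real.exp (-(2 * a * B)))) := by
      intro a ha
      have ha0 : 0 ≤ a := by linarith
      have hcore := vanish_core he hc hβ' hβ'8 hY₀ hCη hηex hv hBH hcont h0 hH3 hgr hdec ha hσ hσ1 hR₁
      set W : ℝ × E → ℝ := fun z => z.1 ^ 2 * Real.exp (2 * phiKR a (kA (3 / 4)) (rhoA (3 / 4)) e z)
        with hW
      have hcore' : ∫ z in G, W z * ‖v z‖ ^ 2 ≤ Cη * (331 * (Real.exp (a * B) * KM + 2) + 66) := by
        rw [hBdef]; exact hcore
      -- lower bound of the weight on `G`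
      set m : ℝ := 1 / 4 * Real.exp (-(R₁ ^ 2 / 2)) * Real.exp (2 * a * B) with hm
      have hm0 : 0 < m := by positivity
      have hlow : ∀ z ∈ G, m * ‖v z‖ ^ 2 ≤ W z * ‖v z‖ ^ 2 := by
        intro z hz
        obtain ⟨h1, h2, h3, h4, h5, h6⟩ := hz
        refine mul_le_mul_of_nonneg_right ?_ (sq_nonneg _)
        refine le_trans ?_ (weight2_ge (a := a) he (by linarith))
        have e1 : Real.exp (-(R₁ ^ 2 / 2)) ≤ Real.exp (-(‖z.2‖ ^ 2 - ⟪z.2, e⟫ ^ 2) / 2) := by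
          rw [Real.exp_le_exp]; rw [neg_div]; linarith
        have e2 : Real.exp (2 * a * B) ≤ Real.exp (2 * a * (kA (3 / 4) z.1 * rhoA (3 / 4) ⟪z.2, e⟫)) := by
          rw [Real.exp_le_exp, hBdef]; nlinarith
        exact mul_le_mul (mul_le_mul_of_nonneg_left e1 (by norm_num)) e2 (Real.exp_pos _).le
          (by positivity)
      have cφ : ContinuousOn (phiKR a (kA (3 / 4)) (rhoA (3 / 4)) e) KG :=
        (contDiffOn_phiKR (contDiffOn_kA _) (contDiffOn_rhoA _) a e).continuousOn.mono hKGh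
      have cW : ContinuousOn W KG := (continuous_fst.pow 2).continuousOn.mul (continuousOn_const.mul cφ).rexp
      have hWvG : IntegrableOn (fun z => W z * ‖v z‖ ^ 2) G :=
        ((cW.mul ((hcont.mono hKGc').norm.pow 2)).integrableOn_compact hKGc).mono_set hGKG
      have h1 : m * ∫ z in G, ‖v z‖ ^ 2 ≤ ∫ z in G, W z * ‖v z‖ ^ 2 := by
        rw [← integral_const_mul]
        exact setIntegral_mono_on (hvG.const_mul _) hWvG hGm hlow
      have h2 := h1.trans hcore'
      -- divide by `m`
      have hm' : m⁻¹ = 4 * Real.exp (R₁ ^ 2 / 2) * Real.exp (-(2 * a * B)) := by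
        rw [hm, mul_inv, mul_inv, ← Real.exp_neg, ← Real.exp_neg, neg_neg]; norm_num
      have h3 : ∫ z in G, ‖v z‖ ^ 2 ≤ m⁻¹ * (Cη * (331 * (Real.exp (a * B) * KM + 2) + 66)) := by
        rw [le_inv_mul_iff₀ hm0]; exact h2
      refine h3.trans (le_of_eq ?_)
      rw [hm']
      have e3 : Real.exp (-(2 * a * B)) * Real.exp (a * B) = Real.exp (-(a * B)) := by
        rw [← Real.exp_add]; congr 1; ring
      calc 4 * Real.exp (R₁ ^ 2 / 2) * Real.exp (-(2 * a * B)) * (Cη * (331 * (Real.exp (a * B) * KM + 2) + 66))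
          = 4 * Real.exp (R₁ ^ 2 / 2) * (Cη * (331 * KM * (Real.exp (-(2 * a * B)) * Real.exp (a * B)) +
            728 * Real.exp (-(2 * a * B)))) := by ring
        _ = _ := by rw [e3]
    -- ### the limit `a → ∞`
    have hlim : Tendsto (fun a : ℝ => 4 * Real.exp (R₁ ^ 2 / 2) * (Cη * (331 * KM * Real.exp (-(a * B)) +
        728 * Real.exp (-(2 * a * B))))) atTop (𝓝 0) := by
      have h1 : Tendsto (fun a : ℝ => Real.exp (-(a * B))) atTop (𝓝 0) :=
        Real.tendsto_exp_neg_atTop_nhds_zero.comp (tendsto_id.atTop_mul_const hB0)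
      have h2 : Tendsto (fun a : ℝ => Real.exp (-(2 * a * B))) atTop (𝓝 0) := by
        have h3 : Tendsto (fun a : ℝ => 2 * a * B) atTop atTop :=
          (tendsto_id.const_mul_atTop (by norm_num : (0 : ℝ) < 2)).atTop_mul_const hB0
        exact Real.tendsto_exp_neg_atTop_nhds_zero.comp h3
      have h4 := ((h1.const_mul (331 * KM)).add (h2.const_mul 728)).const_mul (4 * Real.exp (R₁ ^ 2 / 2) * Cη)
      rw [mul_zero, mul_zero, add_zero, mul_zero] at h4
      refine h4.congr fun a => ?_
      ring
    refine le_antisymm ?_ hI0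
    refine le_of_forall_pos_le_add fun ε hε => ?_
    obtain ⟨a₀, ha₀⟩ := eventually_atTop.1 (hlim.eventually_le_const hε)
    have h1 := hbound (max a₀ 2) (le_max_right _ _)
    have h2 := ha₀ (max a₀ 2) (le_max_left _ _)
    linarith
  -- ### Step 2: pointwise vanishing
  intro z hz hs1 hk
  have hzO : z ∈ O := hz
  obtain ⟨⟨hs0, -⟩, hyH⟩ := hz
  have hyH' : 0 < ⟪z.2, e⟫ := hyH
  by_contra hne
  have hvz : 0 < ‖v z‖ := norm_pos_iff.2 hne
  -- `yₙ(z) ≥ Y₀ + 1 ≥ 2`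
  have hyn1 : 1 ≤ ⟪z.2, e⟫ := by
    by_contra hlt
    push Not at hlt
    obtain ⟨hk0, hk1⟩ := kA_mem_Icc hs0.le hs1.le
    have hρ1 : rhoA (3 / 4) ⟪z.2, e⟫ ≤ 1 := by
      rw [rhoA]; exact Real.rpow_le_one hyH'.le hlt.le (by norm_num)
    have hρ0 := rhoA_nonneg hyH'.le
    have : kA (3 / 4) z.1 * rhoA (3 / 4) ⟪z.2, e⟫ ≤ 1 := by
      calc kA (3 / 4) z.1 * rhoA (3 / 4) ⟪z.2, e⟫ ≤ 1 * 1 := mul_le_mul hk1 hρ1 hρ0 zero_le_one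
        _ = 1 := one_mul _
    nlinarith
  have hyn2 : Y₀ + 1 ≤ ⟪z.2, e⟫ :=
    yn_ge_of_krho_ge hs0.le hs1.le hyn1 (by linarith) (by nlinarith)
  -- parameters `σ`, `R₁`
  set σ : ℝ := min ((z.1 - 1 / 2) / 2) (1 / 4) with hσ
  have hσ0 : 0 < σ := lt_min (by linarith) (by norm_num)
  have hσ1 : σ ≤ 1 / 4 := min_le_right _ _
  have hσs : σ ≤ (z.1 - 1 / 2) / 2 := min_le_left _ _
  set R₁ : ℝ := ‖z.2‖ + 2 with hR₁
  have hR₁1 : 1 ≤ R₁ := by rw [hR₁]; linarith [norm_nonneg z.2]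
  obtain ⟨hvG, hG0⟩ := hzero σ R₁ hσ0 hσ1 hR₁1
  -- continuity of `kρ` and of `v` at `z`
  have hkcont : ContinuousAt (fun w : ℝ × E => kA (3 / 4) w.1 * rhoA (3 / 4) ⟪w.2, e⟫) z := by
    have h1 : ContinuousAt (kA (3 / 4)) z.1 :=
      (contDiffOn_kA _).continuousOn.continuousAt (isOpen_Ioi.mem_nhds (by linarith : (0 : ℝ) < z.1))
    have h2 : ContinuousAt (rhoA (3 / 4)) ⟪z.2, e⟫ :=
      (contDiffOn_rhoA _).continuousOn.continuousAt (isOpen_Ioi.mem_nhds hyH')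
    have h3 : ContinuousAt (fun w : ℝ × E => ⟪w.2, e⟫) z :=
      (continuous_snd.inner continuous_const).continuousAt
    have h4 : ContinuousAt (fun w : ℝ × E => rhoA (3 / 4) ⟪w.2, e⟫) z :=
      ContinuousAt.comp (f := fun w : ℝ × E => ⟪w.2, e⟫) h2 h3
    have h5 : ContinuousAt (fun w : ℝ × E => kA (3 / 4) w.1) z :=
      ContinuousAt.comp (f := fun w : ℝ × E => w.1) h1 continuousAt_fst
    exact h5.mul h4
  have hev1 : ∀ᶠ w in 𝓝 z, 4 * (Y₀ + 1) ^ 2 + 8 < kA (3 / 4) w.1 * rhoA (3 / 4) ⟪w.2, e⟫ :=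
    hkcont.eventually (lt_mem_nhds hk)
  obtain ⟨r₁, hr₁, hr₁'⟩ := Metric.eventually_nhds_iff.1 hev1
  have hvcont : ContinuousAt v z := hv.continuousOn.continuousAt (hOo.mem_nhds hzO)
  obtain ⟨r₂, hr₂, hr₂'⟩ := Metric.continuousAt_iff.1 hvcont (‖v z‖ / 2) (by positivity)
  set r : ℝ := min (min r₁ r₂) (min ((z.1 - 1 / 2) / 2) (min ((1 - z.1) / 2) 1)) with hr
  have hr0 : 0 < r := lt_min (lt_min hr₁ hr₂) (lt_min (by linarith) (lt_min (by linarith) zero_lt_one))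
  have hrr₁ : r ≤ r₁ := le_trans (min_le_left _ _) (min_le_left _ _)
  have hrr₂ : r ≤ r₂ := le_trans (min_le_left _ _) (min_le_right _ _)
  have hrs : r ≤ (z.1 - 1 / 2) / 2 := le_trans (min_le_right _ _) (min_le_left _ _)
  have hrs' : r ≤ (1 - z.1) / 2 := le_trans (min_le_right _ _) (le_trans (min_le_right _ _) (min_le_left _ _))
  have hr1 : r ≤ 1 := le_trans (min_le_right _ _) (le_trans (min_le_right _ _) (min_le_right _ _))
  -- the ball `B(z, r)` lies in `G`
  have hball : ball z r ⊆ {w : ℝ × E | 1 / 2 + σ ≤ w.1 ∧ w.1 ≤ 1 ∧ 1 ≤ ⟪w.2, e⟫ ∧ ⟪w.2, e⟫ ≤ R₁ ∧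
      ‖w.2‖ ^ 2 - ⟪w.2, e⟫ ^ 2 ≤ R₁ ^ 2 ∧ 4 * (Y₀ + 1) ^ 2 + 8 ≤ kA (3 / 4) w.1 * rhoA (3 / 4) ⟪w.2, e⟫} := by
    intro w hw
    rw [mem_ball] at hw
    have hw1 : dist w.1 z.1 < r := lt_of_le_of_lt (by rw [Prod.dist_eq]; exact le_max_left _ _) hw
    have hw2 : dist w.2 z.2 < r := lt_of_le_of_lt (by rw [Prod.dist_eq]; exact le_max_right _ _) hw
    rw [Real.dist_eq] at hw1
    rw [dist_eq_norm] at hw2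
    have hws := abs_lt.1 hw1
    have hye : |⟪w.2, e⟫ - ⟪z.2, e⟫| ≤ ‖w.2 - z.2‖ := by
      rw [← inner_sub_left]
      have := abs_real_inner_le_norm (w.2 - z.2) e
      rwa [he, mul_one] at this
    have hye' := abs_le.1 hye
    have hnw : ‖w.2‖ ≤ ‖z.2‖ + r := by
      have := norm_le_norm_add_norm_sub' w.2 z.2  -- ‖w‖ ≤ ‖z‖ + ‖w - z‖
      linarith
    have hwn : ⟪w.2, e⟫ ≤ ‖w.2‖ := by
      have := real_inner_le_norm w.2 e; rwa [he, mul_one] at this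
    refine ⟨by linarith, by linarith, by linarith, by linarith, ?_, (hr₁' (lt_of_lt_of_le hw hrr₁)).le⟩
    have h1 : ‖w.2‖ ^ 2 ≤ R₁ ^ 2 := by
      rw [hR₁]
      exact pow_le_pow_left₀ (norm_nonneg _) (by linarith) 2
    nlinarith [sq_nonneg ⟪w.2, e⟫]
  -- the integral over the ball is positive
  have hballm : MeasurableSet (ball z r) := measurableSet_ball
  have hvol0 : 0 < volume (ball z r) := Metric.measure_ball_pos volume z hr0
  have hvoltop : volume (ball z r) < ∞ := measure_ball_lt_top
  have hlowpt : ∀ w ∈ ball z r, ‖v z‖ ^ 2 / 4 ≤ ‖v w‖ ^ 2 := by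
    intro w hw
    rw [mem_ball] at hw
    have h1 : dist (v w) (v z) < ‖v z‖ / 2 := hr₂' (lt_of_lt_of_le hw hrr₂)
    rw [dist_eq_norm] at h1
    have h2 : ‖v z‖ / 2 ≤ ‖v w‖ := by
      have := norm_sub_norm_le (v z) (v w)
      rw [← norm_neg, neg_sub] at h1
      linarith
    have h3 : (‖v z‖ / 2) ^ 2 ≤ ‖v w‖ ^ 2 := pow_le_pow_left₀ (by positivity) h2 2
    linarith
  have hIpos : ‖v z‖ ^ 2 / 4 * (volume (ball z r)).toReal ≤ ∫ w in ball z r, ‖v w‖ ^ 2 := by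
    have e1 : ∫ w in ball z r, ‖v z‖ ^ 2 / 4 = ‖v z‖ ^ 2 / 4 * (volume (ball z r)).toReal := by
      rw [setIntegral_const, smul_eq_mul, mul_comm]; rfl
    rw [← e1]
    refine setIntegral_mono_on (integrableOn_const hvoltop.ne) (hvG.mono_set hball) hballm hlowpt
  have hIle : ∫ w in ball z r, ‖v w‖ ^ 2 ≤ 0 := by
    rw [← hG0]
    exact setIntegral_mono_set hvG (ae_of_all _ fun w => sq_nonneg _) (Eventually.of_forall hball)
  have hpos : 0 < ‖v z‖ ^ 2 / 4 * (volume (ball z r)).toReal :=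
    mul_pos (by positivity) (ENNReal.toReal_pos hvol0.ne' hvoltop.ne)
  linarith

end Vanish

end Carleman

end Literature.Analysis.FluidPDE
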